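import Literature.NumberTheory.Automorphic.GJUnfoldingLocal
import Literature.NumberTheory.Automorphic.AdelicTruncation
import Literature.NumberTheory.Automorphic.GodementJacquetZetaIntegrals
import Literature.NumberTheory.Automorphic.AutomorphicLFunctionProofs
import HarnessLib

/-!
# Unfolding the Godement–Jacquet integral over the level `K^T`: the Euler product away from `T`

Topic `NumberTheory/Automorphic`; definitions (`awayFactor`, `awayLevelIn`, `toLocalAway`,
`ofLocalAway`, `IsIntegralAway`, `IsSupportedIn`, `intCosetsIn`, `intCosetsAway`, `stepElt`,
`stepMap`, `stepEquiv`, `unfoldWeight`, `localWeightSum`, `unfoldTerm`, `localEulerInv`) and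
theorems. Third brick (after `AdelicTruncation` and `GJUnfoldingLocal`) of the "`K^T`-spherical
unfolding" by which the named fact
`Literature.NumberTheory.Automorphic.GodementJacquet1972_gjZeta_eulerFactorisation`
(`GodementJacquetZetaIntegrals`; decomposition of `godementJacquet_hasMeromorphicContinuation`,
lang.S21) is proved inside the cuspidal representation `Π ≤ L²`, without Flath's tensor product
theorem or the local theory of admissible representations.

**Setting.** `K` a number field, `T` a finite set of finite places, `H^T = GL_n(𝔸_K^{∞,T})`
(`awayFactor`, the range of the truncation at `e^T`, `AdelicTruncation`), `K^T = ∏_{w ∉ T} GL_n(𝒪_w)`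
as a subgroup of `H^T` (`awayLevelIn`; `mem_awayLevelIn_iff`: `k ∈ K^T ↔ k_w ∈ GL_n(𝒪_w)` for all
`w`), local components `toLocalAway w : H^T → GL_n(K_w)` and embeddings `ofLocalAway : GL_n(K_w) → H^T`
(`w ∉ T`). The integral cosets `Δ^T K^T / K^T` (`intCosetsAway`: cosets `x K^T` with every `x_w`
integral) are exhausted by the cosets `Δ^T[s] K^T / K^T` supported in a finite set of places `s`
(`intCosetsIn`: `x_w ∈ GL_n(𝒪_w)` off `s`; `exists_mem_intCosetsIn`, restricted product).

**Peeling one place** (`stepEquiv`). For `w ∉ T ∪ s₀`,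
`(Δ^{(w)} GL_n(𝒪_w) / GL_n(𝒪_w)) × (Δ^T[s₀] K^T / K^T) ≃ Δ^T[s₀ ∪ {w}] K^T / K^T`, `(y, x) ↦ ι_w(y) x`
(injective: compare `w`-components; surjective: `x = ι_w(x_w) · ι_w(x_w)⁻¹ x`). Along it
`|det|_𝔸` is multiplicative (`adelicAbsDet_stepElt`; `|det|_𝔸 = ∏_w |det ·_w|_w` on `H^T`,
`adelicAbsDet_eq_finprod`, and `|det k|_𝔸 = 1` on `K^T`), and for a `K^T`-fixed `φ` the translate
`R(x) φ`, `x_w ∈ GL_n(𝒪_w)`, is again spherical at `w` (`rightRegular_ofLocal_rightRegular_eq`).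

**The sums.** For `Π` cuspidal with Satake family `α` off `T` (`IsSatakeFamilyOf`), `φ ∈ Π^{K^T}`,
`ψ ∈ L²` and `re s ≥ n² + n + 2`:
* `hasSum_unfoldWeight`: `∑_{x K^T ∈ Δ^T[S] K^T/K^T} |det x|_𝔸^σ = ∏_{w ∈ S} Λ_w(σ)` with the local
  counting series `Λ_w` (`localWeightSum`, `hasSum_norm_det_rpow`: `1 ≤ Λ_w ≤ 1 + 2 q_w^{-σ} 2^n q_w^{n²}`);
* `hasSum_unfoldTerm`: `∑_{x K^T ∈ Δ^T[S] K^T/K^T} |det x|_𝔸^s ⟪ψ, R(x) φ⟫ =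
  (∏_{w ∈ S} (∏_{a ∈ α w} (1 - q_w^{(n-1)/2} a q_w^{-s}))⁻¹) ⟪ψ, φ⟫` (induction on `S`; at each peeled
  place the inner sum is the unramified local factor by `hasSum_intCosets_inner_rightRegularLocal` of
  `GJUnfoldingLocal`, i.e. Tamagawa's identity and the scalar action of the spherical Hecke algebra
  on `Π^{GL_n(𝒪_w)}`);
* `summable_unfoldWeight`, `summable_norm_unfoldTerm`: absolute convergence over *all* integral
  cosets (uniform bound `∏ Λ_w ≤ exp ∑_w 2 q_w^{-σ} 2^n q_w^{n²}`, `summable_residueCard_rpow_neg`);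
* `hasSum_unfoldTerm_intCosetsAway` (**main**): the Euler product
  `∏_{w ∉ T} (∏_{a ∈ α w} (1 - q_w^{(n-1)/2} a q_w^{-s}))⁻¹` converges (`Multipliable`) and
  `∑_{x K^T ∈ Δ^T K^T / K^T} |det x|_𝔸^s ⟪ψ, R(x) φ⟫` equals it times `⟪ψ, φ⟫` (Tannery's theorem over
  the integral cosets, `tendsto_prod_localEulerInv_mul_inner`).

The left-hand side is, up to the Haar volume of `K^T`, the integral over `H^T` of
`1_{M_n(𝒪̂^T)}(h) |det h|^s ⟪ψ, R(h) φ⟫` (next file, by `CosetIntegral`); with `ψ = R(a⁻¹) φ'`,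
`a ∈ G_T`, and Fubini over `GL_n(𝔸_K) = G_T × H^T` this gives
`Z(Φ_T ⊗ 1_{M_n(𝒪̂^T)}, s, φ, φ') = vol(K^T) · L^T(s - (n-1)/2, Π) · Z_T(s)` — Godement–Jacquet (1972),
proof of Thm. 13.8, with the unramified computation of Lemma 6.10, in the `L²` model.

## Design notes

* Everything happens inside `GL_n(𝔸_K)`: no restricted-product decomposition `𝔸^{∞} ≅ ∏'` is
  used; local components are `GeneralLinearGroup.map (adeleEval K w)` (equal to
  `(gl n K).toLocal w`, `AdelicGroupData.gl_toLocal`), which avoids the `.Local w` type synonym in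
  rewriting. For the same reason `rightRegular_mul_apply` / `rightRegular_one_apply` restate
  `map_mul` / `map_one` of the regular representation with products taken in
  `GL (Fin n) (AdeleRing (𝓞 K) K)` rather than in the synonym `(gl n K).Adelic`.
* The threshold `re s ≥ n² + n + 2` comes from the crude coset bound `#(Δ_m K/K) ≤ (2^n q^{n²})^m`
  of `GJUnfoldingLocal`; any right half-plane suffices for the intended application.

## References

* R. Godement, H. Jacquet, *Zeta functions of simple algebras*, LNM 260 (1972), §12, Thm. 13.8
  (proof), Lemma 6.10 [GodementJacquet1972] (not held; as used in `GodementJacquetZetaIntegrals`).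
* H. Jacquet, *Principal `L`-functions of the linear group*, Corvallis (1979), Part 2, §6
  [JacquetCorvallis1979].
* A. Weil, *Basic Number Theory* (1967), Ch. IV §1 (adeles away from finitely many places).
-/

noncomputable section

open scoped MatrixGroups NNReal
open NumberField IsDedekindDomain ValuativeRel Literature.LinearAlgebra.Matrix
open Literature.LinearAlgebra.Matrix.Echelon

namespace Literature.NumberTheory.Automorphic

section AwayFactor

variable (K : Type) [Field K] [NumberField K] (n : ℕ) (T : Finset (HeightOneSpectrum (𝓞 K)))

/-- The factor `H^T = GL_n(𝔸_K^{∞,T}) ≤ GL_n(𝔸_K)` of adelic matrices trivial at `∞` and at the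
places of `T` (the range of the truncation at the idempotent `e^T`, `AdelicTruncation`).
[folklore] -/
abbrev awayFactor : Subgroup (GL (Fin n) (AdeleRing (𝓞 K) K)) :=
  (truncGL (Fin n) (isIdempotentElem_adeleAwayIdem K T)).range

/-- The level `K^T = ∏_{w ∉ T} GL_n(𝒪_w)` as a subgroup *of* `H^T` (`awayLevel` of
`AdelicTruncation`, `Subgroup.subgroupOf`). [folklore] -/
abbrev awayLevelIn : Subgroup (awayFactor K n T) :=
  (awayLevel K n T).subgroupOf (awayFactor K n T)

/-- The local component `H^T → GL_n(K_w)` at a finite place (`GeneralLinearGroup.map` of the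
evaluation `𝔸_K → K_w`, i.e. `(gl n K).toLocal w` restricted to `H^T`). [folklore] -/
abbrev toLocalAway (w : HeightOneSpectrum (𝓞 K)) : awayFactor K n T →* GL (Fin n) (w.adicCompletion K) :=
  (Matrix.GeneralLinearGroup.map (n := Fin n) (AdelicGroupData.adeleEval K w)).comp
    (awayFactor K n T).subtype

variable {K n T}

/-- The local embedding `GL_n(K_w) → H^T` for `w ∉ T` (`GLn.ofLocal`, which lands in `H^T` by
`ofLocal_mem_range_truncGL`). [folklore] -/
def ofLocalAway {w : HeightOneSpectrum (𝓞 K)} (hw : w ∉ T) :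
    GL (Fin n) (w.adicCompletion K) →* awayFactor K n T :=
  (GLn.ofLocal n K w).codRestrict _ fun g => ofLocal_mem_range_truncGL n T hw g

/-- `ofLocalAway` is `GLn.ofLocal` in `GL_n(𝔸_K)` (definitional). [folklore] -/
@[simp]
theorem coe_ofLocalAway {w : HeightOneSpectrum (𝓞 K)} (hw : w ∉ T) (g : GL (Fin n) (w.adicCompletion K)) :
    ((ofLocalAway hw g : awayFactor K n T) : GL (Fin n) (AdeleRing (𝓞 K) K)) = GLn.ofLocal n K w g :=
  rfl

/-- Unfolding `toLocalAway`. [folklore] -/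
theorem toLocalAway_apply (w : HeightOneSpectrum (𝓞 K)) (x : awayFactor K n T) :
    toLocalAway K n T w x =
      Matrix.GeneralLinearGroup.map (AdelicGroupData.adeleEval K w) (x : GL (Fin n) (AdeleRing (𝓞 K) K)) :=
  rfl

/-- `(ι_w y)_w = y`. [folklore] -/
@[simp]
theorem toLocalAway_ofLocalAway {w : HeightOneSpectrum (𝓞 K)} (hw : w ∉ T)
    (g : GL (Fin n) (w.adicCompletion K)) : toLocalAway K n T w (ofLocalAway hw g) = g :=
  GLn.toLocal_ofLocal g

/-- `(ι_w y)_{w'} = 1` for `w' ≠ w`. [folklore] -/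
theorem toLocalAway_ofLocalAway_of_ne {w w' : HeightOneSpectrum (𝓞 K)} (hw : w ∉ T) (h : w' ≠ w)
    (g : GL (Fin n) (w.adicCompletion K)) : toLocalAway K n T w' (ofLocalAway hw g) = 1 :=
  GLn.toLocal_ofLocal_of_ne h g

/-- An element of `H^T` with trivial `w`-component commutes with `ι_w(GL_n(K_w))`. [folklore] -/
theorem ofLocalAway_mul_eq_mul {w : HeightOneSpectrum (𝓞 K)} (hw : w ∉ T)
    (g : GL (Fin n) (w.adicCompletion K)) {x : awayFactor K n T} (hx : toLocalAway K n T w x = 1) :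
    ofLocalAway hw g * x = x * ofLocalAway hw g :=
  Subtype.ext (GLn.ofLocal_mul_eq_mul_ofLocal_of_toLocal_eq_one g hx)

/-- Elements of `H^T` have trivial archimedean part. [folklore] -/
theorem fstHom_coe_eq_one (x : awayFactor K n T) :
    GLn.fstHom n K (x : GL (Fin n) (AdeleRing (𝓞 K) K)) = 1 :=
  ((mem_range_truncGL_adeleAwayIdem_iff n T x.1).1 x.2).1

/-- Elements of `H^T` have trivial components at the places of `T`. [folklore] -/
theorem toLocalAway_eq_one_of_mem {w : HeightOneSpectrum (𝓞 K)} (hw : w ∈ T) (x : awayFactor K n T) :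
    toLocalAway K n T w x = 1 :=
  ((mem_range_truncGL_adeleAwayIdem_iff n T x.1).1 x.2).2 w hw

/-- **Integrality of the finite part, place by place**: for `g ∈ GL_n(𝔸_K)` with trivial
archimedean part, `g ∈ K^max = {1} × GL_n(𝒪̂)` iff every local component lies in `GL_n(𝒪_w)`.
[folklore] -/
theorem mem_glIntegralLevel_iff_forall_map {g : GL (Fin n) (AdeleRing (𝓞 K) K)}
    (hg : GLn.fstHom n K g = 1) :
    g ∈ glIntegralLevel n K ↔ ∀ w, Matrix.GeneralLinearGroup.map (AdelicGroupData.adeleEval K w) g ∈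
      glInt n (w.adicCompletion K) := by
  constructor
  · intro h w
    rw [glInt_adicCompletion_eq]
    exact toLocal_mem_valuedCongruenceSubgroup_one h w
  · intro h
    rw [mem_glIntegralLevel_iff]
    refine ⟨?_, hg⟩
    rw [mem_glFiniteIntegralLevel_iff]
    refine ⟨fun i j => ?_, fun i j => ?_⟩
    · rw [mem_integralFiniteAdeles_iff]
      intro w
      have hw := (mem_glInt_iff _).1 (h w)
      exact (mem_integer_adicCompletion_iff K w).1 (hw.1 i j)
    · rw [mem_integralFiniteAdeles_iff]
      intro w
      have hw := (mem_glInt_iff _).1 (h w)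
      have := hw.2 i j
      rw [← Matrix.GeneralLinearGroup.map_inv] at this
      rw [← map_inv]
      exact (mem_integer_adicCompletion_iff K w).1 this

/-- **Membership in `K^T ≤ H^T`, place by place**: `k ∈ K^T ↔ k_w ∈ GL_n(𝒪_w)` for every finite
place `w` (at `w ∈ T` the component is `1`). [folklore] -/
theorem mem_awayLevelIn_iff (k : awayFactor K n T) :
    k ∈ awayLevelIn K n T ↔ ∀ w, toLocalAway K n T w k ∈ glInt n (w.adicCompletion K) := by
  rw [Subgroup.mem_subgroupOf, mem_awayLevel_iff, and_iff_right k.2,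
    mem_glIntegralLevel_iff_forall_map (fstHom_coe_eq_one k)]
  rfl

/-- `ι_w(GL_n(𝒪_w)) ≤ K^T` for `w ∉ T`. [folklore] -/
theorem ofLocalAway_mem_awayLevelIn {w : HeightOneSpectrum (𝓞 K)} (hw : w ∉ T)
    {g : GL (Fin n) (w.adicCompletion K)} (hg : g ∈ glInt n (w.adicCompletion K)) :
    ofLocalAway hw g ∈ awayLevelIn K n T := by
  rw [mem_awayLevelIn_iff]
  intro w'
  by_cases h : w' = w
  · subst h
    rwa [toLocalAway_ofLocalAway]
  · rw [toLocalAway_ofLocalAway_of_ne hw h]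
    exact one_mem _

end AwayFactor

/-! ### Integral cosets of `H^T` modulo `K^T` and their support -/

section Cosets

variable {K : Type} [Field K] [NumberField K] {n : ℕ} {T : Finset (HeightOneSpectrum (𝓞 K))}

/-- `x ∈ H^T` is **integral away from `T`**: every local component is an integral matrix
(`x ∈ Δ^T = H^T ∩ M_n(𝒪̂^T)`; at `w ∈ T` the component is `1`). [folklore] -/
def IsIntegralAway (x : awayFactor K n T) : Prop :=
  ∀ w, IsIntegralMatrix ((toLocalAway K n T w x : GL (Fin n) (w.adicCompletion K)) :
    Matrix (Fin n) (Fin n) (w.adicCompletion K))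

/-- `x ∈ H^T` is **supported in `s`**: its local components outside the finite set `s` lie in
`GL_n(𝒪_w)`. Every `x` is supported in some `s` (restricted product). [folklore] -/
def IsSupportedIn (s : Finset (HeightOneSpectrum (𝓞 K))) (x : awayFactor K n T) : Prop :=
  ∀ w ∉ s, toLocalAway K n T w x ∈ glInt n (w.adicCompletion K)

/-- Integrality is preserved by right multiplication by `K^T`. [folklore] -/
theorem IsIntegralAway.mul_of_mem {x k : awayFactor K n T} (hx : IsIntegralAway x)
    (hk : k ∈ awayLevelIn K n T) : IsIntegralAway (x * k) := fun w => by
  rw [map_mul, Units.val_mul]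
  exact (hx w).mul (isIntegralMatrix_of_mem_glInt ((mem_awayLevelIn_iff k).1 hk w))

/-- Integrality is invariant under right multiplication by `K^T`. [folklore] -/
theorem isIntegralAway_mul_iff {x k : awayFactor K n T} (hk : k ∈ awayLevelIn K n T) :
    IsIntegralAway (x * k) ↔ IsIntegralAway x := by
  refine ⟨fun h => ?_, fun h => h.mul_of_mem hk⟩
  have h' := h.mul_of_mem (inv_mem hk)
  rwa [mul_inv_cancel_right] at h'

/-- The support condition is invariant under right multiplication by `K^T`. [folklore] -/
theorem isSupportedIn_mul_iff {s : Finset (HeightOneSpectrum (𝓞 K))} {x k : awayFactor K n T}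
    (hk : k ∈ awayLevelIn K n T) : IsSupportedIn s (x * k) ↔ IsSupportedIn s x := by
  have hk' := (mem_awayLevelIn_iff k).1 hk
  refine ⟨fun h w hw => ?_, fun h w hw => ?_⟩
  · have := mul_mem (h w hw) (inv_mem (hk' w))
    rwa [map_mul, mul_inv_cancel_right] at this
  · rw [map_mul]
    exact mul_mem (h w hw) (hk' w)

/-- Supports may be enlarged. [folklore] -/
theorem IsSupportedIn.mono {s t : Finset (HeightOneSpectrum (𝓞 K))} (hst : s ⊆ t) {x : awayFactor K n T}
    (h : IsSupportedIn s x) : IsSupportedIn t x := fun w hw => h w fun hws => hw (hst hws)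

/-- A representative of the coset `x K^T` differs from `x` by an element of `K^T`. [folklore] -/
theorem exists_out_eq_mul (x : awayFactor K n T) :
    ∃ k ∈ awayLevelIn K n T, ((x : awayFactor K n T ⧸ awayLevelIn K n T).out : awayFactor K n T) = x * k := by
  obtain ⟨k, hk⟩ := QuotientGroup.mk_out_eq_mul (awayLevelIn K n T) x
  exact ⟨k, k.2, hk⟩

variable (K n T) in
/-- The set `Δ^T[s] K^T / K^T` of cosets of `K^T` in `H^T` represented by integral matrices supported
in the finite set of places `s` (both conditions are independent of the representative). [folklore] -/
def intCosetsIn (s : Finset (HeightOneSpectrum (𝓞 K))) : Set (awayFactor K n T ⧸ awayLevelIn K n T) :=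
  {γ | IsIntegralAway γ.out ∧ IsSupportedIn s γ.out}

variable (K n T) in
/-- The set `Δ^T K^T / K^T` of all integral cosets of `K^T` in `H^T`. [folklore] -/
def intCosetsAway : Set (awayFactor K n T ⧸ awayLevelIn K n T) :=
  {γ | IsIntegralAway γ.out}

/-- Membership of `x K^T` in `Δ^T[s] K^T / K^T` is read on `x`. [folklore] -/
theorem mk_mem_intCosetsIn_iff {s : Finset (HeightOneSpectrum (𝓞 K))} (x : awayFactor K n T) :
    (x : awayFactor K n T ⧸ awayLevelIn K n T) ∈ intCosetsIn K n T s ↔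
      IsIntegralAway x ∧ IsSupportedIn s x := by
  obtain ⟨k, hk, hx⟩ := exists_out_eq_mul x
  simp only [intCosetsIn, Set.mem_setOf_eq, hx, isIntegralAway_mul_iff hk, isSupportedIn_mul_iff hk]

/-- Membership of `x K^T` in `Δ^T K^T / K^T` is read on `x`. [folklore] -/
theorem mk_mem_intCosetsAway_iff (x : awayFactor K n T) :
    (x : awayFactor K n T ⧸ awayLevelIn K n T) ∈ intCosetsAway K n T ↔ IsIntegralAway x := by
  obtain ⟨k, hk, hx⟩ := exists_out_eq_mul x
  simp only [intCosetsAway, Set.mem_setOf_eq, hx, isIntegralAway_mul_iff hk]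

/-- `Δ^T[s] K^T / K^T ⊆ Δ^T K^T / K^T`. [folklore] -/
theorem intCosetsIn_subset_intCosetsAway (s : Finset (HeightOneSpectrum (𝓞 K))) :
    intCosetsIn K n T s ⊆ intCosetsAway K n T := fun _ h => h.1

/-- `Δ^T[s] K^T / K^T` grows with `s`. [folklore] -/
theorem intCosetsIn_mono {s t : Finset (HeightOneSpectrum (𝓞 K))} (hst : s ⊆ t) :
    intCosetsIn K n T s ⊆ intCosetsIn K n T t := fun _ h => ⟨h.1, h.2.mono hst⟩

/-- **Every adelic matrix is supported in a finite set of places**: the entries of `x` and `x⁻¹`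
are `w`-integral for almost all `w` (restricted product). [folklore] -/
theorem exists_isSupportedIn (x : awayFactor K n T) : ∃ s, IsSupportedIn s x := by
  set g : GL (Fin n) (AdeleRing (𝓞 K) K) := (x : GL (Fin n) (AdeleRing (𝓞 K) K)) with hg
  have h1 : ∀ᶠ w : HeightOneSpectrum (𝓞 K) in Filter.cofinite, ∀ ij : Fin n × Fin n,
      ((g : Matrix (Fin n) (Fin n) (AdeleRing (𝓞 K) K)) ij.1 ij.2).2 w ∈ w.adicCompletionIntegers K :=
    Filter.eventually_all.2 fun ij => ((g : Matrix (Fin n) (Fin n) (AdeleRing (𝓞 K) K)) ij.1 ij.2).2.2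
  have h2 : ∀ᶠ w : HeightOneSpectrum (𝓞 K) in Filter.cofinite, ∀ ij : Fin n × Fin n,
      (((g⁻¹ : GL (Fin n) (AdeleRing (𝓞 K) K)) : Matrix (Fin n) (Fin n) (AdeleRing (𝓞 K) K))
        ij.1 ij.2).2 w ∈ w.adicCompletionIntegers K :=
    Filter.eventually_all.2 fun ij =>
      ((((g⁻¹ : GL (Fin n) (AdeleRing (𝓞 K) K)) : Matrix (Fin n) (Fin n) (AdeleRing (𝓞 K) K))
        ij.1 ij.2).2.2)
  have h := (h1.and h2)
  rw [Filter.eventually_cofinite] at h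
  refine ⟨h.toFinset, fun w hw => ?_⟩
  rw [Set.Finite.mem_toFinset, Set.mem_setOf_eq, not_not] at hw
  rw [mem_glInt_iff]
  refine ⟨fun i j => ?_, fun i j => ?_⟩
  · exact (mem_integer_adicCompletion_iff K w).2 (hw.1 (i, j))
  · rw [← map_inv]
    exact (mem_integer_adicCompletion_iff K w).2 (hw.2 (i, j))

/-- `Δ^T K^T / K^T = ⋃_s Δ^T[s] K^T / K^T`. [folklore] -/
theorem exists_mem_intCosetsIn {γ : awayFactor K n T ⧸ awayLevelIn K n T} (hγ : γ ∈ intCosetsAway K n T) :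
    ∃ s, γ ∈ intCosetsIn K n T s := by
  obtain ⟨s, hs⟩ := exists_isSupportedIn (γ.out : awayFactor K n T)
  exact ⟨s, hγ, hs⟩

/-- `Δ^T[∅] K^T / K^T = {K^T}`: a coset supported nowhere is the trivial coset. [folklore] -/
theorem mem_intCosetsIn_empty_iff (γ : awayFactor K n T ⧸ awayLevelIn K n T) :
    γ ∈ intCosetsIn K n T ∅ ↔ γ = ((1 : awayFactor K n T) : awayFactor K n T ⧸ awayLevelIn K n T) := by
  constructor
  · rintro ⟨-, hs⟩
    have hout : (γ.out : awayFactor K n T) ∈ awayLevelIn K n T :=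
      (mem_awayLevelIn_iff _).2 fun w => hs w (Finset.notMem_empty w)
    rw [← QuotientGroup.out_eq' γ, QuotientGroup.eq, mul_one]
    exact inv_mem hout
  · rintro rfl
    rw [mk_mem_intCosetsIn_iff]
    exact ⟨fun w => by rw [map_one, Units.val_one]; exact IsIntegralMatrix.one,
      fun w _ => by rw [map_one]; exact one_mem _⟩

end Cosets

/-! ### Peeling off one place: `Δ^T[s ∪ {w}] K^T / K^T ≃ (Δ^{(w)} GL_n(𝒪_w) / GL_n(𝒪_w)) × Δ^T[s] K^T / K^T` -/

section Step

open scoped Classical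

variable {K : Type} [Field K] [NumberField K] {n : ℕ} {T : Finset (HeightOneSpectrum (𝓞 K))}
  {w : HeightOneSpectrum (𝓞 K)}

/-- `(ι_w(y) x)_w = y x_w`. [folklore] -/
theorem toLocalAway_ofLocalAway_mul (hw : w ∉ T) (y : GL (Fin n) (w.adicCompletion K)) (x : awayFactor K n T) :
    toLocalAway K n T w (ofLocalAway hw y * x) = y * toLocalAway K n T w x := by
  rw [map_mul, toLocalAway_ofLocalAway]

/-- `(ι_w(y) x)_{w'} = x_{w'}` for `w' ≠ w`. [folklore] -/
theorem toLocalAway_ofLocalAway_mul_of_ne (hw : w ∉ T) {w' : HeightOneSpectrum (𝓞 K)} (h : w' ≠ w)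
    (y : GL (Fin n) (w.adicCompletion K)) (x : awayFactor K n T) :
    toLocalAway K n T w' (ofLocalAway hw y * x) = toLocalAway K n T w' x := by
  rw [map_mul, toLocalAway_ofLocalAway_of_ne hw h, one_mul]

/-- The element `ι_w(y) x ∈ H^T` assembled from a representative `y` of an integral coset at `w`
and a representative `x` of a coset of `K^T`. [folklore] -/
def stepElt (hw : w ∉ T) (c : intCosets n (w.adicCompletion K))
    (γ' : awayFactor K n T ⧸ awayLevelIn K n T) : awayFactor K n T :=
  ofLocalAway hw (c.1.out : GL (Fin n) (w.adicCompletion K)) * γ'.out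

/-- Unfolding `stepElt`. [folklore] -/
theorem stepElt_def (hw : w ∉ T) (c : intCosets n (w.adicCompletion K))
    (γ' : awayFactor K n T ⧸ awayLevelIn K n T) :
    stepElt hw c γ' = ofLocalAway hw (c.1.out : GL (Fin n) (w.adicCompletion K)) * γ'.out := rfl

/-- `ι_w(y) x` is integral if `y` is and `x` is integral with `x_w ∈ GL_n(𝒪_w)`. [folklore] -/
theorem isIntegralAway_stepElt (hw : w ∉ T) {s₀ : Finset (HeightOneSpectrum (𝓞 K))} (hws : w ∉ s₀)
    (c : intCosets n (w.adicCompletion K)) {γ' : awayFactor K n T ⧸ awayLevelIn K n T}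
    (hγ' : γ' ∈ intCosetsIn K n T s₀) : IsIntegralAway (stepElt hw c γ') := by
  intro w'
  by_cases h : w' = w
  · subst h
    rw [stepElt_def, toLocalAway_ofLocalAway_mul, isIntegralMatrix_mul_glInt_iff (hγ'.2 _ hws)]
    exact c.2
  · rw [stepElt_def, toLocalAway_ofLocalAway_mul_of_ne hw h]
    exact hγ'.1 w'

/-- `ι_w(y) x` is supported in `s₀ ∪ {w}` if `x` is supported in `s₀`. [folklore] -/
theorem isSupportedIn_stepElt (hw : w ∉ T) {s₀ : Finset (HeightOneSpectrum (𝓞 K))}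
    (c : intCosets n (w.adicCompletion K)) {γ' : awayFactor K n T ⧸ awayLevelIn K n T}
    (hγ' : γ' ∈ intCosetsIn K n T s₀) : IsSupportedIn (insert w s₀) (stepElt hw c γ') := by
  intro w' hw'
  rw [Finset.mem_insert, not_or] at hw'
  rw [stepElt_def, toLocalAway_ofLocalAway_mul_of_ne hw hw'.1]
  exact hγ'.2 w' hw'.2

/-- **The peeling map** `(y GL_n(𝒪_w), x K^T) ↦ ι_w(y) x K^T` from integral cosets at `w` times
cosets supported in `s₀` to cosets supported in `s₀ ∪ {w}` (`w ∉ T`, `w ∉ s₀`). [folklore] -/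
def stepMap (hw : w ∉ T) {s₀ : Finset (HeightOneSpectrum (𝓞 K))} (hws : w ∉ s₀)
    (p : intCosets n (w.adicCompletion K) × intCosetsIn K n T s₀) : intCosetsIn K n T (insert w s₀) :=
  ⟨(stepElt hw p.1 p.2.1 : awayFactor K n T ⧸ awayLevelIn K n T),
    (mk_mem_intCosetsIn_iff _).2
      ⟨isIntegralAway_stepElt hw hws p.1 p.2.2, isSupportedIn_stepElt hw p.1 p.2.2⟩⟩

/-- Unfolding `stepMap`. [folklore] -/
theorem coe_stepMap (hw : w ∉ T) {s₀ : Finset (HeightOneSpectrum (𝓞 K))} (hws : w ∉ s₀)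
    (p : intCosets n (w.adicCompletion K) × intCosetsIn K n T s₀) :
    ((stepMap hw hws p : intCosetsIn K n T (insert w s₀)) : awayFactor K n T ⧸ awayLevelIn K n T) =
      (stepElt hw p.1 p.2.1 : awayFactor K n T ⧸ awayLevelIn K n T) := rfl

/-- The peeling map is injective (compare `w`-components, then the remaining cosets). [folklore] -/
theorem stepMap_injective (hw : w ∉ T) {s₀ : Finset (HeightOneSpectrum (𝓞 K))} (hws : w ∉ s₀) :
    Function.Injective (stepMap (n := n) hw hws) := by
  rintro ⟨c₁, γ₁⟩ ⟨c₂, γ₂⟩ h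
  have h' : (stepElt hw c₁ γ₁.1 : awayFactor K n T ⧸ awayLevelIn K n T) = stepElt hw c₂ γ₂.1 :=
    congrArg Subtype.val h
  rw [QuotientGroup.eq] at h'
  have hk := (mem_awayLevelIn_iff _).1 h'
  -- the `w`-components: `y₁⁻¹ y₂ ∈ GL_n(𝒪_w)`
  have a₁ := γ₁.2.2 w hws
  have a₂ := γ₂.2.2 w hws
  have hw₁ := hk w
  rw [map_mul, map_inv, stepElt_def, stepElt_def, toLocalAway_ofLocalAway_mul,
    toLocalAway_ofLocalAway_mul] at hw₁
  have hy : ((c₁.1.out : GL (Fin n) (w.adicCompletion K)))⁻¹ * c₂.1.out ∈ glInt n (w.adicCompletion K) := by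
    have e : ((c₁.1.out : GL (Fin n) (w.adicCompletion K)))⁻¹ * c₂.1.out =
        toLocalAway K n T w γ₁.1.out *
          (((c₁.1.out : GL (Fin n) (w.adicCompletion K)) * toLocalAway K n T w γ₁.1.out)⁻¹ *
            (c₂.1.out * toLocalAway K n T w γ₂.1.out)) * (toLocalAway K n T w γ₂.1.out)⁻¹ := by
      group
    rw [e]
    exact mul_mem (mul_mem a₁ hw₁) (inv_mem a₂)
  have hc : c₁ = c₂ := by
    apply Subtype.ext
    rw [← QuotientGroup.out_eq' c₁.1, ← QuotientGroup.out_eq' c₂.1, QuotientGroup.eq]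
    exact hy
  subst hc
  -- the remaining cosets
  have hγ : γ₁ = γ₂ := by
    apply Subtype.ext
    rw [← QuotientGroup.out_eq' γ₁.1, ← QuotientGroup.out_eq' γ₂.1, QuotientGroup.eq]
    rw [stepElt_def, stepElt_def, mul_inv_rev, mul_assoc, inv_mul_cancel_left] at h'
    exact h'
  rw [hγ]

/-- The peeling map is surjective: `x K^T = ι_w(x_w) · (ι_w(x_w)⁻¹ x) K^T`. [folklore] -/
theorem stepMap_surjective (hw : w ∉ T) {s₀ : Finset (HeightOneSpectrum (𝓞 K))} (hws : w ∉ s₀) :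
    Function.Surjective (stepMap (n := n) hw hws) := by
  rintro ⟨γ, hγ⟩
  set g : awayFactor K n T := γ.out with hg
  set y : GL (Fin n) (w.adicCompletion K) := toLocalAway K n T w g with hy
  set x' : awayFactor K n T := (ofLocalAway hw y)⁻¹ * g with hx'
  have hx'w : toLocalAway K n T w x' = 1 := by
    rw [hx', map_mul, map_inv, toLocalAway_ofLocalAway, hy, inv_mul_cancel]
  have hx'ne : ∀ w' ≠ w, toLocalAway K n T w' x' = toLocalAway K n T w' g := fun w' h => by
    rw [hx', map_mul, map_inv, toLocalAway_ofLocalAway_of_ne hw h, inv_one, one_mul]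
  have hγ' : (x' : awayFactor K n T ⧸ awayLevelIn K n T) ∈ intCosetsIn K n T s₀ := by
    rw [mk_mem_intCosetsIn_iff]
    refine ⟨fun w' => ?_, fun w' hw' => ?_⟩
    · by_cases h : w' = w
      · subst h; rw [hx'w, Units.val_one]; exact IsIntegralMatrix.one
      · rw [hx'ne w' h]; exact hγ.1 w'
    · by_cases h : w' = w
      · subst h; rw [hx'w]; exact one_mem _
      · rw [hx'ne w' h]
        exact hγ.2 w' (by rw [Finset.mem_insert, not_or]; exact ⟨h, hw'⟩)
  let c : intCosets n (w.adicCompletion K) := ⟨(y : GL (Fin n) (w.adicCompletion K) ⧸ glInt n _),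
    (mk_mem_intCosets_iff y).2 (hγ.1 w)⟩
  refine ⟨(c, ⟨(x' : awayFactor K n T ⧸ awayLevelIn K n T), hγ'⟩), Subtype.ext ?_⟩
  rw [coe_stepMap]
  change (stepElt hw c (x' : awayFactor K n T ⧸ awayLevelIn K n T) : awayFactor K n T ⧸ awayLevelIn K n T) = γ
  -- representatives
  obtain ⟨k₀, hk₀⟩ := QuotientGroup.mk_out_eq_mul (glInt n (w.adicCompletion K)) y
  obtain ⟨k, hk, hk'⟩ := exists_out_eq_mul x'
  rw [stepElt_def]
  change ((ofLocalAway hw ((y : GL (Fin n) (w.adicCompletion K) ⧸ glInt n _).out) *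
    ((x' : awayFactor K n T ⧸ awayLevelIn K n T).out) : awayFactor K n T) : _ ⧸ awayLevelIn K n T) = γ
  rw [hk₀, hk', map_mul, ← QuotientGroup.out_eq' γ, QuotientGroup.eq, ← hg]
  have hcomm : ofLocalAway hw (k₀ : GL (Fin n) (w.adicCompletion K)) * x' =
      x' * ofLocalAway hw (k₀ : GL (Fin n) (w.adicCompletion K)) := ofLocalAway_mul_eq_mul hw _ hx'w
  have e : g⁻¹ * (ofLocalAway hw y * ofLocalAway hw (k₀ : GL (Fin n) (w.adicCompletion K)) * (x' * k)) =
      ofLocalAway hw (k₀ : GL (Fin n) (w.adicCompletion K)) * k := by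
    rw [mul_assoc (ofLocalAway hw y), ← mul_assoc (ofLocalAway hw _) x' k, hcomm, hx']
    group
  rw [← Subgroup.inv_mem_iff, mul_inv_rev, inv_inv, e]
  exact mul_mem (ofLocalAway_mem_awayLevelIn hw k₀.2) hk

/-- **Peeling off one place.** For `w ∉ T`, `w ∉ s₀`:
`(Δ^{(w)} GL_n(𝒪_w) / GL_n(𝒪_w)) × (Δ^T[s₀] K^T / K^T) ≃ Δ^T[s₀ ∪ {w}] K^T / K^T`,
`(y, x) ↦ ι_w(y) x` — the combinatorial form of `GL_n(𝔸^{∞,T}) = ∏'_w GL_n(K_w)` with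
`K^T = ∏ GL_n(𝒪_w)` used to unfold the zeta integral place by place (Godement–Jacquet (1972),
§12; Jacquet (1979), §6). [folklore] -/
def stepEquiv (hw : w ∉ T) {s₀ : Finset (HeightOneSpectrum (𝓞 K))} (hws : w ∉ s₀) :
    intCosets n (w.adicCompletion K) × intCosetsIn K n T s₀ ≃ intCosetsIn K n T (insert w s₀) :=
  Equiv.ofBijective (stepMap hw hws) ⟨stepMap_injective hw hws, stepMap_surjective hw hws⟩

/-- Unfolding `stepEquiv`. [folklore] -/
theorem coe_stepEquiv (hw : w ∉ T) {s₀ : Finset (HeightOneSpectrum (𝓞 K))} (hws : w ∉ s₀)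
    (p : intCosets n (w.adicCompletion K) × intCosetsIn K n T s₀) :
    ((stepEquiv hw hws p : intCosetsIn K n T (insert w s₀)) : awayFactor K n T ⧸ awayLevelIn K n T) =
      (stepElt hw p.1 p.2.1 : awayFactor K n T ⧸ awayLevelIn K n T) := rfl

end Step

/-! ### The module `|det|_𝔸` and the regular representation on the away factor -/

section DetRep

open scoped Classical
open MeasureTheory

variable {K : Type} [Field K] [NumberField K] {n : ℕ} {T : Finset (HeightOneSpectrum (𝓞 K))}

/-- The archimedean component of `det g` is `det g_∞`. [folklore] -/
theorem fst_coe_det (g : GL (Fin n) (AdeleRing (𝓞 K) K)) :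
    ((Matrix.GeneralLinearGroup.det g : (AdeleRing (𝓞 K) K)ˣ) : AdeleRing (𝓞 K) K).1 =
      ((GLn.fstHom n K g : GL (Fin n) (InfiniteAdeleRing K)) : Matrix (Fin n) (Fin n) (InfiniteAdeleRing K)).det := by
  rw [Matrix.GeneralLinearGroup.val_det_apply]
  exact RingHom.map_det (RingHom.fst (InfiniteAdeleRing K) (FiniteAdeleRing (𝓞 K) K)) _

/-- The `w`-component of `det g` is `det g_w`. [folklore] -/
theorem adeleEval_coe_det (w : HeightOneSpectrum (𝓞 K)) (g : GL (Fin n) (AdeleRing (𝓞 K) K)) :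
    AdelicGroupData.adeleEval K w
        ((Matrix.GeneralLinearGroup.det g : (AdeleRing (𝓞 K) K)ˣ) : AdeleRing (𝓞 K) K) =
      ((Matrix.GeneralLinearGroup.map (AdelicGroupData.adeleEval K w) g :
        GL (Fin n) (w.adicCompletion K)) : Matrix (Fin n) (Fin n) (w.adicCompletion K)).det := by
  rw [Matrix.GeneralLinearGroup.val_det_apply]
  exact RingHom.map_det (AdelicGroupData.adeleEval K w) _

/-- **`|det g|_𝔸 = ∏_w |det g_w|_w` for `g` with trivial archimedean part.** [folklore] -/
theorem adelicAbsDet_eq_finprod {g : GL (Fin n) (AdeleRing (𝓞 K) K)} (hg : GLn.fstHom n K g = 1) :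
    adelicAbsDet n K g = ∏ᶠ w : HeightOneSpectrum (𝓞 K),
      ‖((Matrix.GeneralLinearGroup.map (AdelicGroupData.adeleEval K w) g :
        GL (Fin n) (w.adicCompletion K)) : Matrix (Fin n) (Fin n) (w.adicCompletion K)).det‖₊ := by
  rw [adelicAbsDet_apply, ideleNorm_apply]
  have h1 : ∀ v : InfinitePlace K,
      ‖((Matrix.GeneralLinearGroup.det g : (AdeleRing (𝓞 K) K)ˣ) : AdeleRing (𝓞 K) K).1 v‖₊ ^ v.mult = 1 := by
    intro v
    rw [fst_coe_det, hg, Units.val_one, Matrix.det_one, show (1 : InfiniteAdeleRing K) v = 1 from rfl,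
      nnnorm_one, one_pow]
  rw [Finset.prod_eq_one fun v _ => h1 v, one_mul]
  refine finprod_congr fun w => ?_
  rw [← adeleEval_coe_det]
  rfl

/-- `|det ι_w(y)|_𝔸 = |det y|_w`. [folklore] -/
theorem adelicAbsDet_ofLocal (w : HeightOneSpectrum (𝓞 K)) (y : GL (Fin n) (w.adicCompletion K)) :
    adelicAbsDet n K (GLn.ofLocal n K w y) =
      ‖(y : Matrix (Fin n) (Fin n) (w.adicCompletion K)).det‖₊ := by
  have hfst : GLn.fstHom n K (GLn.ofLocal n K w y) = 1 :=
    ((mem_range_truncGL_adeleAwayIdem_iff n ∅ _).1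
      (ofLocal_mem_range_truncGL n ∅ (Finset.notMem_empty w) y)).1
  rw [adelicAbsDet_eq_finprod hfst]
  rw [finprod_eq_single _ w fun w' hw' => ?_]
  · have h : Matrix.GeneralLinearGroup.map (AdelicGroupData.adeleEval K w) (GLn.ofLocal n K w y) = y :=
      GLn.toLocal_ofLocal (n := n) (K := K) (v := w) y
    rw [h]
  · have h : Matrix.GeneralLinearGroup.map (AdelicGroupData.adeleEval K w') (GLn.ofLocal n K w y) = 1 :=
      GLn.toLocal_ofLocal_of_ne (n := n) (K := K) hw' y
    rw [h, Units.val_one, Matrix.det_one, nnnorm_one]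

/-- `|det k|_w = 1` for `k ∈ GL_n(𝒪_w)`. [folklore] -/
theorem norm_det_eq_one_of_mem_glInt {w : HeightOneSpectrum (𝓞 K)} {k : GL (Fin n) (w.adicCompletion K)}
    (hk : k ∈ glInt n (w.adicCompletion K)) :
    ‖(k : Matrix (Fin n) (Fin n) (w.adicCompletion K)).det‖ = 1 := by
  have h := valuation_det_eq_one_of_mem_glInt hk
  rw [← (valuation (w.adicCompletion K)).map_one] at h
  rw [norm_eq_norm_of_valuation_eq h, norm_one]

/-- **`|det k|_𝔸 = 1` on the level `K^T`.** [folklore] -/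
theorem adelicAbsDet_eq_one_of_mem_awayLevelIn {k : awayFactor K n T} (hk : k ∈ awayLevelIn K n T) :
    adelicAbsDet n K (k : GL (Fin n) (AdeleRing (𝓞 K) K)) = 1 := by
  rw [adelicAbsDet_eq_finprod (fstHom_coe_eq_one k)]
  refine finprod_eq_one_of_forall_eq_one fun w => ?_
  have h := norm_det_eq_one_of_mem_glInt ((mem_awayLevelIn_iff k).1 hk w)
  rw [toLocalAway_apply] at h
  exact NNReal.coe_injective (by rw [coe_nnnorm, h]; rfl)

/-- `|det|_𝔸` is constant on the cosets of `K^T`: `|det (x K^T).out| = |det x|`. [folklore] -/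
theorem adelicAbsDet_out_mk (x : awayFactor K n T) :
    adelicAbsDet n K (((x : awayFactor K n T ⧸ awayLevelIn K n T).out : awayFactor K n T) :
        GL (Fin n) (AdeleRing (𝓞 K) K)) =
      adelicAbsDet n K (x : GL (Fin n) (AdeleRing (𝓞 K) K)) := by
  obtain ⟨k, hk, hx⟩ := exists_out_eq_mul x
  rw [hx, Subgroup.coe_mul, map_mul, adelicAbsDet_eq_one_of_mem_awayLevelIn hk, mul_one]

/-- `|det (ι_w(y) x)|_𝔸 = |det y|_w |det x|_𝔸`. [folklore] -/
theorem adelicAbsDet_stepElt {w : HeightOneSpectrum (𝓞 K)} (hw : w ∉ T)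
    (c : intCosets n (w.adicCompletion K)) (γ' : awayFactor K n T ⧸ awayLevelIn K n T) :
    adelicAbsDet n K (stepElt hw c γ' : GL (Fin n) (AdeleRing (𝓞 K) K)) =
      ‖((c.1.out : GL (Fin n) (w.adicCompletion K)) : Matrix (Fin n) (Fin n) (w.adicCompletion K)).det‖₊ *
        adelicAbsDet n K ((γ'.out : awayFactor K n T) : GL (Fin n) (AdeleRing (𝓞 K) K)) := by
  rw [stepElt_def, Subgroup.coe_mul, map_mul, coe_ofLocalAway, adelicAbsDet_ofLocal]

variable (μ : Measure (AdelicGroupData.gl n K).automorphicQuotient)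
  [(AdelicGroupData.gl n K).IsAutomorphicMeasure μ]

/-- `R(a b) φ = R(a) (R(b) φ)` with the product taken in `GL_n(𝔸_K)` (a `rw`-friendly form of
`map_mul` for the regular representation). [folklore] -/
theorem rightRegular_mul_apply (a b : GL (Fin n) (AdeleRing (𝓞 K) K)) (φ : (AdelicGroupData.gl n K).L2 μ) :
    (AdelicGroupData.gl n K).rightRegular μ (a * b) φ =
      (AdelicGroupData.gl n K).rightRegular μ a ((AdelicGroupData.gl n K).rightRegular μ b φ) :=
  DFunLike.congr_fun (map_mul ((AdelicGroupData.gl n K).rightRegular μ) a b) φ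

/-- `R(1) φ = φ` with `1 ∈ GL_n(𝔸_K)` (a `rw`-friendly form of `map_one`). [folklore] -/
theorem rightRegular_one_apply (φ : (AdelicGroupData.gl n K).L2 μ) :
    (AdelicGroupData.gl n K).rightRegular μ (1 : GL (Fin n) (AdeleRing (𝓞 K) K)) φ = φ :=
  DFunLike.congr_fun (map_one ((AdelicGroupData.gl n K).rightRegular μ)) φ

variable {μ}

/-- `R((x K^T).out) φ = R(x) φ` for a `K^T`-fixed `φ`. [folklore] -/
theorem rightRegular_out_mk {φ : (AdelicGroupData.gl n K).L2 μ}
    (hφ : ∀ k ∈ awayLevel K n T, (AdelicGroupData.gl n K).rightRegular μ k φ = φ) (x : awayFactor K n T) :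
    (AdelicGroupData.gl n K).rightRegular μ
        (((x : awayFactor K n T ⧸ awayLevelIn K n T).out : awayFactor K n T) : GL (Fin n) (AdeleRing (𝓞 K) K)) φ =
      (AdelicGroupData.gl n K).rightRegular μ (x : GL (Fin n) (AdeleRing (𝓞 K) K)) φ := by
  obtain ⟨k, hk, hx⟩ := exists_out_eq_mul x
  rw [hx, Subgroup.coe_mul, rightRegular_mul_apply, hφ _ (Subgroup.mem_subgroupOf.1 hk)]

/-- **Translates by elements integral-unit at `w` stay spherical at `w`.** If `x ∈ H^T` has
`x_w ∈ GL_n(𝒪_w)` and `φ` is `K^T`-fixed (`w ∉ T`), then `R(x) φ` is fixed by `ι_w(GL_n(𝒪_w))`: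
write `x = ι_w(x_w) x''` with `x''_w = 1` commuting with `ι_w(·)`. [folklore] -/
theorem rightRegular_ofLocal_rightRegular_eq {w : HeightOneSpectrum (𝓞 K)} (hw : w ∉ T)
    {φ : (AdelicGroupData.gl n K).L2 μ}
    (hφ : ∀ k ∈ awayLevel K n T, (AdelicGroupData.gl n K).rightRegular μ k φ = φ)
    {x : awayFactor K n T} (hx : toLocalAway K n T w x ∈ glInt n (w.adicCompletion K))
    {k : GL (Fin n) (w.adicCompletion K)} (hk : k ∈ glInt n (w.adicCompletion K)) :
    (AdelicGroupData.gl n K).rightRegular μ (GLn.ofLocal n K w k)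
        ((AdelicGroupData.gl n K).rightRegular μ (x : GL (Fin n) (AdeleRing (𝓞 K) K)) φ) =
      (AdelicGroupData.gl n K).rightRegular μ (x : GL (Fin n) (AdeleRing (𝓞 K) K)) φ := by
  set a : GL (Fin n) (w.adicCompletion K) := toLocalAway K n T w x with ha
  set x'' : awayFactor K n T := (ofLocalAway hw a)⁻¹ * x with hx''
  have hx''w : toLocalAway K n T w x'' = 1 := by
    rw [hx'', map_mul, map_inv, toLocalAway_ofLocalAway, ha, inv_mul_cancel]
  have hxe : x = ofLocalAway hw a * x'' := by rw [hx'', mul_inv_cancel_left]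
  -- both sides equal `R(x'') φ`
  have hR : ∀ b ∈ glInt n (w.adicCompletion K),
      (AdelicGroupData.gl n K).rightRegular μ ((ofLocalAway hw b * x'' : awayFactor K n T) :
          GL (Fin n) (AdeleRing (𝓞 K) K)) φ =
        (AdelicGroupData.gl n K).rightRegular μ (x'' : GL (Fin n) (AdeleRing (𝓞 K) K)) φ := by
    intro b hb
    rw [ofLocalAway_mul_eq_mul hw b hx''w, Subgroup.coe_mul, rightRegular_mul_apply, coe_ofLocalAway,
      hφ _ (isMaximalAt_awayLevel n T hw ⟨b, by rwa [← glInt_adicCompletion_eq], rfl⟩)]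
  have h1 : (AdelicGroupData.gl n K).rightRegular μ (x : GL (Fin n) (AdeleRing (𝓞 K) K)) φ =
      (AdelicGroupData.gl n K).rightRegular μ (x'' : GL (Fin n) (AdeleRing (𝓞 K) K)) φ := by
    rw [hxe]; exact hR a hx
  have h2 : GLn.ofLocal n K w k * (x : GL (Fin n) (AdeleRing (𝓞 K) K)) =
      ((ofLocalAway hw (k * a) * x'' : awayFactor K n T) : GL (Fin n) (AdeleRing (𝓞 K) K)) := by
    rw [hxe]
    simp only [Subgroup.coe_mul, coe_ofLocalAway, map_mul, mul_assoc]
  rw [← rightRegular_mul_apply, h2, hR _ (mul_mem hk hx), h1]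

end DetRep

/-! ### The counting series at one place, intrinsically -/

section LocalWeight

open scoped Classical

variable {K : Type} [Field K] [NumberField K] {n : ℕ}

/-- `q_w^{-σ} · 2^n q_w^{n²} ≤ 1/2` once `σ ≥ n² + n + 2` (`q_w ≥ 2`): the crude coset bound
`#(Δ_m K/K) ≤ (2^n q_w^{n²})^m` then gives geometric convergence at every finite place, uniformly.
[folklore] -/
theorem rpow_neg_mul_bound_le_half (w : HeightOneSpectrum (𝓞 K)) {σ : ℝ} (hσ : (n : ℝ) * n + n + 2 ≤ σ) :
    (w.residueCard : ℝ) ^ (-σ) * ((2 : ℝ) ^ n * (w.residueCard : ℝ) ^ (n * n)) ≤ 1 / 2 := by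
  have hq : (2 : ℝ) ≤ w.residueCard := by exact_mod_cast w.one_lt_residueCard
  have hq0 : (0 : ℝ) < w.residueCard := by linarith
  have h1 : (w.residueCard : ℝ) ^ (-σ) * (w.residueCard : ℝ) ^ (n * n) ≤ (w.residueCard : ℝ) ^ (-(n : ℝ) - 1) := by
    rw [← Real.rpow_natCast, ← Real.rpow_add hq0]
    exact Real.rpow_le_rpow_of_exponent_le (by linarith) (by push_cast; linarith)
  have h2 : (w.residueCard : ℝ) ^ (-(n : ℝ) - 1) ≤ (2 : ℝ) ^ (-(n : ℝ) - 1) := by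
    have hneg : -(n : ℝ) - 1 ≤ 0 := by linarith [n.cast_nonneg (α := ℝ)]
    exact Real.rpow_le_rpow_of_nonpos (by norm_num) hq hneg
  calc (w.residueCard : ℝ) ^ (-σ) * ((2 : ℝ) ^ n * (w.residueCard : ℝ) ^ (n * n))
      = (2 : ℝ) ^ n * ((w.residueCard : ℝ) ^ (-σ) * (w.residueCard : ℝ) ^ (n * n)) := by ring
    _ ≤ (2 : ℝ) ^ n * (2 : ℝ) ^ (-(n : ℝ) - 1) := by gcongr; exact h1.trans h2
    _ = 1 / 2 := by
        rw [← Real.rpow_natCast, ← Real.rpow_add (by norm_num : (0 : ℝ) < 2)]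
        rw [show ((n : ℕ) : ℝ) + (-(n : ℝ) - 1) = -1 by ring, Real.rpow_neg_one]
        norm_num

/-- Real-power form of `|det y|_w = q_w^{-m(y)}`: `|det y|_w^σ = (q_w^{-σ})^{m(y)}`. [folklore] -/
theorem norm_det_out_rpow_eq {w : HeightOneSpectrum (𝓞 K)} {ϖ : w.adicCompletion K}
    (hval : Valued.v ϖ = WithZero.exp (-1 : ℤ)) (hϖ : IsUniformizingElement ϖ)
    (c : intCosets n (w.adicCompletion K)) (σ : ℝ) :
    ‖((c.1.out : GL (Fin n) (w.adicCompletion K)) : Matrix (Fin n) (Fin n) (w.adicCompletion K)).det‖ ^ σ =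
      ((w.residueCard : ℝ) ^ (-σ)) ^ detExponent hϖ c := by
  have hq0 : (0 : ℝ) ≤ w.residueCard := Nat.cast_nonneg _
  rw [norm_det_out_eq_inv_pow hval hϖ c, ← Real.rpow_natCast, ← Real.rpow_natCast,
    Real.inv_rpow hq0, ← Real.rpow_neg hq0, ← Real.rpow_mul hq0, ← Real.rpow_mul hq0]
  congr 1
  ring

/-- Complex-power form: `|det y|_w^s = (q_w^{-s})^{m(y)}` (as complex numbers). [folklore] -/
theorem norm_det_out_cpow_eq {w : HeightOneSpectrum (𝓞 K)} {ϖ : w.adicCompletion K}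
    (hval : Valued.v ϖ = WithZero.exp (-1 : ℤ)) (hϖ : IsUniformizingElement ϖ)
    (c : intCosets n (w.adicCompletion K)) (s : ℂ) :
    ((‖((c.1.out : GL (Fin n) (w.adicCompletion K)) : Matrix (Fin n) (Fin n) (w.adicCompletion K)).det‖ : ℝ) : ℂ) ^ s =
      ((w.residueCard : ℂ) ^ (-s)) ^ detExponent hϖ c := by
  rw [norm_det_out_eq_inv_pow hval hϖ c, ← inv_natCast_pow_cpow]
  push_cast
  rw [inv_pow]

/-- **The counting series at `w`, intrinsically.** For `σ ≥ n² + n + 2` the series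
`Λ_w(σ) = ∑_{y GL_n(𝒪_w) ⊆ Δ^{(w)}} |det y|_w^σ` converges, `1 ≤ Λ_w(σ)` and
`Λ_w(σ) - 1 ≤ 2 · q_w^{-σ} 2^n q_w^{n²}` (any uniformizer computes it as
`exists_hasSum_intCosets_pow_detExponent`). [folklore] -/
theorem hasSum_norm_det_rpow (w : HeightOneSpectrum (𝓞 K)) {σ : ℝ} (hσ : (n : ℝ) * n + n + 2 ≤ σ) :
    HasSum (fun c : intCosets n (w.adicCompletion K) =>
        ‖((c.1.out : GL (Fin n) (w.adicCompletion K)) : Matrix (Fin n) (Fin n) (w.adicCompletion K)).det‖ ^ σ)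
      (∑' c : intCosets n (w.adicCompletion K),
        ‖((c.1.out : GL (Fin n) (w.adicCompletion K)) : Matrix (Fin n) (Fin n) (w.adicCompletion K)).det‖ ^ σ) ∧
    1 ≤ ∑' c : intCosets n (w.adicCompletion K),
        ‖((c.1.out : GL (Fin n) (w.adicCompletion K)) : Matrix (Fin n) (Fin n) (w.adicCompletion K)).det‖ ^ σ ∧
    (∑' c : intCosets n (w.adicCompletion K),
        ‖((c.1.out : GL (Fin n) (w.adicCompletion K)) : Matrix (Fin n) (Fin n) (w.adicCompletion K)).det‖ ^ σ) - 1 ≤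
      2 * ((w.residueCard : ℝ) ^ (-σ) * ((2 : ℝ) ^ n * (w.residueCard : ℝ) ^ (n * n))) := by
  obtain ⟨ϖu, hval⟩ := exists_valuation_eq_exp_neg_one K w
  have hϖ : IsUniformizingElement (ϖu : w.adicCompletion K) := isUniformizingElement_of_valued_eq K w hval
  have hq : Nat.card 𝓀[w.adicCompletion K] = w.residueCard :=
    natCard_valuativeResidueField_adicCompletion_eq K w
  set D : ℝ := (2 : ℝ) ^ n * (w.residueCard : ℝ) ^ (n * n) with hD
  set t : ℝ := (w.residueCard : ℝ) ^ (-σ) with ht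
  have hD0 : 0 ≤ D := by positivity
  have ht0 : 0 ≤ t := by positivity
  have htD : t * D ≤ 1 / 2 := rpow_neg_mul_bound_le_half w hσ
  have htD1 : t * D < 1 := by linarith
  have hcard : ∀ m, ((finite_cosets_glIntDet (n := n) hϖ m).toFinset.card : ℝ) ≤ D ^ m := fun m => by
    have h1 := card_cosets_glIntDet_le_pow (n := n) hϖ m
    have h2 := ncard_orbit_heckeDiag_one_le (n := n) hϖ
    rw [hq] at h2
    calc ((finite_cosets_glIntDet (n := n) hϖ m).toFinset.card : ℝ)
        ≤ ((MulAction.orbit (glInt n (w.adicCompletion K))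
            ((heckeDiag n (Units.mk0 (ϖu : w.adicCompletion K) hϖ.ne_zero) 1 :
              GL (Fin n) (w.adicCompletion K)) :
                GL (Fin n) (w.adicCompletion K) ⧸ glInt n (w.adicCompletion K))).ncard : ℝ) ^ m := by
          exact_mod_cast h1
      _ ≤ D ^ m := by
          gcongr
          rw [hD]
          exact_mod_cast h2
  obtain ⟨Λ, hΛ, h1, h2⟩ := exists_hasSum_intCosets_pow_detExponent hϖ hD0 ht0 hcard htD1
  have hΛ' : HasSum (fun c : intCosets n (w.adicCompletion K) =>
      ‖((c.1.out : GL (Fin n) (w.adicCompletion K)) : Matrix (Fin n) (Fin n) (w.adicCompletion K)).det‖ ^ σ) Λ := by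
    refine hΛ.congr_fun fun c => ?_
    rw [norm_det_out_rpow_eq hval hϖ c σ]
  rw [hΛ'.tsum_eq]
  refine ⟨hΛ', h1, h2.trans ?_⟩
  rw [div_le_iff₀ (by linarith)]
  nlinarith [mul_nonneg ht0 hD0]

end LocalWeight

/-! ### The sums over integral cosets: weights -/

section Weights

open scoped Classical
open MeasureTheory

variable {K : Type} [Field K] [NumberField K] {n : ℕ} {T : Finset (HeightOneSpectrum (𝓞 K))}

variable (K n T) in
/-- The weight `|det x|_𝔸^σ` of a coset `x K^T` (independent of the representative). [folklore] -/
def unfoldWeight (σ : ℝ) (γ : awayFactor K n T ⧸ awayLevelIn K n T) : ℝ :=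
  (adelicAbsDet n K ((γ.out : awayFactor K n T) : GL (Fin n) (AdeleRing (𝓞 K) K)) : ℝ) ^ σ

/-- The weight is non-negative. [folklore] -/
theorem unfoldWeight_nonneg (σ : ℝ) (γ : awayFactor K n T ⧸ awayLevelIn K n T) : 0 ≤ unfoldWeight K n T σ γ :=
  Real.rpow_nonneg (NNReal.coe_nonneg _) _

/-- The weight of `x K^T` is `|det x|_𝔸^σ`. [folklore] -/
theorem unfoldWeight_mk (σ : ℝ) (x : awayFactor K n T) :
    unfoldWeight K n T σ (x : awayFactor K n T ⧸ awayLevelIn K n T) =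
      (adelicAbsDet n K (x : GL (Fin n) (AdeleRing (𝓞 K) K)) : ℝ) ^ σ := by
  rw [unfoldWeight, adelicAbsDet_out_mk]

/-- Multiplicativity of the weight along the peeling map. [folklore] -/
theorem unfoldWeight_stepElt {w : HeightOneSpectrum (𝓞 K)} (hw : w ∉ T) (σ : ℝ)
    (c : intCosets n (w.adicCompletion K)) (γ' : awayFactor K n T ⧸ awayLevelIn K n T) :
    unfoldWeight K n T σ (stepElt hw c γ' : awayFactor K n T ⧸ awayLevelIn K n T) =
      ‖((c.1.out : GL (Fin n) (w.adicCompletion K)) : Matrix (Fin n) (Fin n) (w.adicCompletion K)).det‖ ^ σ *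
        unfoldWeight K n T σ γ' := by
  rw [unfoldWeight_mk, adelicAbsDet_stepElt, NNReal.coe_mul, coe_nnnorm,
    Real.mul_rpow (norm_nonneg _) (NNReal.coe_nonneg _)]
  rfl

variable (n) in
/-- The counting series `Λ_w(σ) = ∑_{y GL_n(𝒪_w) ⊆ Δ^{(w)}} |det y|_w^σ` at a finite place. [folklore] -/
def localWeightSum (w : HeightOneSpectrum (𝓞 K)) (σ : ℝ) : ℝ :=
  ∑' c : intCosets n (w.adicCompletion K),
    ‖((c.1.out : GL (Fin n) (w.adicCompletion K)) : Matrix (Fin n) (Fin n) (w.adicCompletion K)).det‖ ^ σ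

/-- **The weight sum over the cosets supported in `s` is the product of the local counting series**:
`∑_{x K^T ∈ Δ^T[s] K^T/K^T} |det x|_𝔸^σ = ∏_{w ∈ s} Λ_w(σ)` for `s` disjoint from `T` and
`σ ≥ n² + n + 2` (peel off the places of `s` one at a time, `stepEquiv`). [folklore] -/
theorem hasSum_unfoldWeight {σ : ℝ} (hσ : (n : ℝ) * n + n + 2 ≤ σ) (s : Finset (HeightOneSpectrum (𝓞 K)))
    (hs : ∀ w ∈ s, w ∉ T) :
    HasSum (fun γ : intCosetsIn K n T s => unfoldWeight K n T σ γ.1) (∏ w ∈ s, localWeightSum n w σ) := by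
  induction s using Finset.induction_on with
  | empty =>
    have h1 : ((1 : awayFactor K n T) : awayFactor K n T ⧸ awayLevelIn K n T) ∈ intCosetsIn K n T ∅ :=
      (mem_intCosetsIn_empty_iff _).2 rfl
    letI : Unique (intCosetsIn K n T (∅ : Finset (HeightOneSpectrum (𝓞 K)))) :=
      ⟨⟨⟨_, h1⟩⟩, fun γ => Subtype.ext ((mem_intCosetsIn_empty_iff _).1 γ.2)⟩
    have hval : unfoldWeight K n T σ ((1 : awayFactor K n T) : awayFactor K n T ⧸ awayLevelIn K n T) = 1 := by
      rw [unfoldWeight_mk, Subgroup.coe_one, map_one, NNReal.coe_one, Real.one_rpow]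
    rw [Finset.prod_empty]
    convert hasSum_fintype (fun γ : intCosetsIn K n T (∅ : Finset (HeightOneSpectrum (𝓞 K))) =>
      unfoldWeight K n T σ γ.1)
    rw [Finset.univ_unique, Finset.sum_singleton]
    exact hval.symm
  | insert w s₀ hw₀ ih =>
    have hwT : w ∉ T := hs w (Finset.mem_insert_self w s₀)
    have ih' := ih fun w' hw' => hs w' (Finset.mem_insert_of_mem hw')
    have hloc := (hasSum_norm_det_rpow (n := n) w hσ).1
    have hprod := hloc.mul ih' (hloc.summable.mul_of_nonneg ih'.summable
      (fun c => Real.rpow_nonneg (norm_nonneg _) _) (fun γ => unfoldWeight_nonneg σ γ.1))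
    rw [Finset.prod_insert hw₀]
    refine ((stepEquiv hwT hw₀).hasSum_iff (f := fun γ : intCosetsIn K n T (insert w s₀) =>
      unfoldWeight K n T σ γ.1)).1 (hprod.congr_fun fun p => ?_)
    change unfoldWeight K n T σ ((stepEquiv hwT hw₀ p : intCosetsIn K n T (insert w s₀)) :
      awayFactor K n T ⧸ awayLevelIn K n T) = _
    rw [coe_stepEquiv, unfoldWeight_stepElt]

end Weights

/-! ### The sums over integral cosets: the unfolded coefficient -/

section Terms

open scoped Classical InnerProductSpace
open MeasureTheory

variable {K : Type} [Field K] [NumberField K] {n : ℕ} {T : Finset (HeightOneSpectrum (𝓞 K))}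
  {μ : Measure (AdelicGroupData.gl n K).automorphicQuotient}
  [(AdelicGroupData.gl n K).IsAutomorphicMeasure μ]

variable (K n T μ) in
/-- The summand `|det x|_𝔸^s ⟪ψ, R(x) φ⟫` of the unfolded zeta integral at the coset `x K^T`
(evaluated at the chosen representative; for `K^T`-fixed `φ` it does not depend on the choice,
`unfoldTerm_mk`). [folklore] -/
def unfoldTerm (φ ψ : (AdelicGroupData.gl n K).L2 μ) (s : ℂ) (γ : awayFactor K n T ⧸ awayLevelIn K n T) : ℂ :=
  ((adelicAbsDet n K ((γ.out : awayFactor K n T) : GL (Fin n) (AdeleRing (𝓞 K) K)) : ℝ) : ℂ) ^ s *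
    ⟪ψ, (AdelicGroupData.gl n K).rightRegular μ ((γ.out : awayFactor K n T) : GL (Fin n) (AdeleRing (𝓞 K) K)) φ⟫_ℂ

/-- For a `K^T`-fixed `φ`, `unfoldTerm (x K^T) = |det x|_𝔸^s ⟪ψ, R(x) φ⟫` for any representative
`x`. [folklore] -/
theorem unfoldTerm_mk {φ : (AdelicGroupData.gl n K).L2 μ}
    (hφ : ∀ k ∈ awayLevel K n T, (AdelicGroupData.gl n K).rightRegular μ k φ = φ)
    (ψ : (AdelicGroupData.gl n K).L2 μ) (s : ℂ) (x : awayFactor K n T) :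
    unfoldTerm K n T μ φ ψ s (x : awayFactor K n T ⧸ awayLevelIn K n T) =
      ((adelicAbsDet n K (x : GL (Fin n) (AdeleRing (𝓞 K) K)) : ℝ) : ℂ) ^ s *
        ⟪ψ, (AdelicGroupData.gl n K).rightRegular μ (x : GL (Fin n) (AdeleRing (𝓞 K) K)) φ⟫_ℂ := by
  rw [unfoldTerm, adelicAbsDet_out_mk, rightRegular_out_mk hφ]

/-- `|unfoldTerm| ≤ ‖ψ‖ ‖φ‖ |det|^{re s}` (unitarity of `R`). [folklore] -/
theorem norm_unfoldTerm_le (φ ψ : (AdelicGroupData.gl n K).L2 μ) (s : ℂ) (γ : awayFactor K n T ⧸ awayLevelIn K n T) :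
    ‖unfoldTerm K n T μ φ ψ s γ‖ ≤ ‖ψ‖ * ‖φ‖ * unfoldWeight K n T s.re γ := by
  rw [unfoldTerm, norm_mul, Complex.norm_cpow_eq_rpow_re_of_pos (adelicAbsDet_pos _), unfoldWeight, mul_comm]
  refine mul_le_mul_of_nonneg_right ?_ (Real.rpow_nonneg (NNReal.coe_nonneg _) _)
  rw [← AdelicGroupData.norm_rightRegular_apply (𝒢 := AdelicGroupData.gl n K) μ
    ((γ.out : awayFactor K n T) : GL (Fin n) (AdeleRing (𝓞 K) K)) φ]
  exact norm_inner_le_norm _ _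

/-- The summand along the peeling map:
`unfoldTerm (ι_w(y) x) = |det x|^s · (|det y|_w^s ⟪ψ, R(ι_w y) R(x) φ⟫)`. [folklore] -/
theorem unfoldTerm_stepElt {w : HeightOneSpectrum (𝓞 K)} (hw : w ∉ T) {φ : (AdelicGroupData.gl n K).L2 μ}
    (hφ : ∀ k ∈ awayLevel K n T, (AdelicGroupData.gl n K).rightRegular μ k φ = φ)
    (ψ : (AdelicGroupData.gl n K).L2 μ) (s : ℂ)
    (c : intCosets n (w.adicCompletion K)) (γ' : awayFactor K n T ⧸ awayLevelIn K n T) :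
    unfoldTerm K n T μ φ ψ s (stepElt hw c γ' : awayFactor K n T ⧸ awayLevelIn K n T) =
      ((adelicAbsDet n K ((γ'.out : awayFactor K n T) : GL (Fin n) (AdeleRing (𝓞 K) K)) : ℝ) : ℂ) ^ s *
        (((‖((c.1.out : GL (Fin n) (w.adicCompletion K)) : Matrix (Fin n) (Fin n) (w.adicCompletion K)).det‖ : ℝ) : ℂ) ^ s *
          ⟪ψ, (AdelicGroupData.gl n K).rightRegular μ (GLn.ofLocal n K w (c.1.out : GL (Fin n) (w.adicCompletion K)))
            ((AdelicGroupData.gl n K).rightRegular μ ((γ'.out : awayFactor K n T) : GL (Fin n) (AdeleRing (𝓞 K) K)) φ)⟫_ℂ) := by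
  rw [unfoldTerm_mk hφ, adelicAbsDet_stepElt, NNReal.coe_mul, coe_nnnorm, Complex.ofReal_mul,
    Complex.mul_cpow_ofReal_nonneg (norm_nonneg _) (NNReal.coe_nonneg _), stepElt_def, Subgroup.coe_mul,
    coe_ofLocalAway, rightRegular_mul_apply]
  ring

variable (n) in
/-- The **unramified local factor** `(∏_{a ∈ α} (1 - q_w^{(n-1)/2} a q_w^{-s}))⁻¹` of the unfolded
zeta integral at `w` (for the Satake parameter `α`); equal to `L(s - (n-1)/2, Π_w)` when
`#α = n`. [folklore] -/
def localEulerInv (α : Multiset ℂ) (w : HeightOneSpectrum (𝓞 K)) (s : ℂ) : ℂ :=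
  ((α.map fun a => 1 - ((Real.sqrt (w.residueCard : ℝ) : ℝ) : ℂ) ^ (n - 1) * a *
    (w.residueCard : ℂ) ^ (-s)).prod)⁻¹

/-- `‖q_w^{-s}‖ · 2^n q_w^{n²} ≤ 1/2 < 1` in the half-plane `re s ≥ n² + n + 2`. [folklore] -/
theorem norm_cpow_neg_mul_lt_one (w : HeightOneSpectrum (𝓞 K)) {s : ℂ} (hs : (n : ℝ) * n + n + 2 ≤ s.re) :
    ‖(w.residueCard : ℂ) ^ (-s)‖ * ((2 : ℝ) ^ n * (w.residueCard : ℝ) ^ (n * n)) < 1 := by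
  rw [Complex.norm_natCast_cpow_of_pos (lt_trans zero_lt_one w.one_lt_residueCard), Complex.neg_re]
  linarith [rpow_neg_mul_bound_le_half (n := n) w hs]

/-- **The unfolded coefficient over the cosets supported in `S`** is
`(∏_{w ∈ S} L_w) ⟪ψ, φ⟫`: for `Π` cuspidal with Satake family `α` off `T`, `φ ∈ Π^{K^T}`, `ψ ∈ L²`,
`S` disjoint from `T` and `re s ≥ n² + n + 2`,
`∑_{x K^T ∈ Δ^T[S] K^T / K^T} |det x|_𝔸^s ⟪ψ, R(x) φ⟫ = (∏_{w ∈ S} (∏_{a ∈ α w}(1 - q_w^{(n-1)/2} a q_w^{-s}))⁻¹) ⟪ψ, φ⟫`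
(absolutely convergent). Induction on `S`, peeling a place `w` with `stepEquiv`: for fixed `x`
supported in `S ∖ {w}` the vector `R(x) φ` is spherical at `w` (`rightRegular_ofLocal_rightRegular_eq`)
and the sum over the integral cosets at `w` is the local factor times `⟪ψ, R(x) φ⟫`
(`hasSum_intCosets_inner_rightRegularLocal`, i.e. Tamagawa's identity and the scalar action of the
unramified Hecke algebra on `Π^{GL_n(𝒪_w)}`). This is the Euler factorisation of the unramified
part of the Godement–Jacquet integral, obtained inside `Π` (Godement–Jacquet (1972), §12 and
Lemma 6.10; Jacquet (1979), §6). [cite: GodementJacquet1972, Lemma 6.10] -/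
theorem hasSum_unfoldTerm (P : CuspidalAutomorphicRepGL n K μ) {α : SatakeFamily K}
    (hα : IsSatakeFamilyOf P (↑T : Set (HeightOneSpectrum (𝓞 K))) α)
    {φ : (AdelicGroupData.gl n K).L2 μ} (hφP : φ ∈ P.1)
    (hφ : ∀ k ∈ awayLevel K n T, (AdelicGroupData.gl n K).rightRegular μ k φ = φ)
    (ψ : (AdelicGroupData.gl n K).L2 μ) {s : ℂ} (hs : (n : ℝ) * n + n + 2 ≤ s.re)
    (S : Finset (HeightOneSpectrum (𝓞 K))) (hS : ∀ w ∈ S, w ∉ T) :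
    HasSum (fun γ : intCosetsIn K n T S => unfoldTerm K n T μ φ ψ s γ.1)
      ((∏ w ∈ S, localEulerInv n (α w) w s) * ⟪ψ, φ⟫_ℂ) := by
  induction S using Finset.induction_on with
  | empty =>
    have h1 : ((1 : awayFactor K n T) : awayFactor K n T ⧸ awayLevelIn K n T) ∈ intCosetsIn K n T ∅ :=
      (mem_intCosetsIn_empty_iff _).2 rfl
    letI : Unique (intCosetsIn K n T (∅ : Finset (HeightOneSpectrum (𝓞 K)))) :=
      ⟨⟨⟨_, h1⟩⟩, fun γ => Subtype.ext ((mem_intCosetsIn_empty_iff _).1 γ.2)⟩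
    have hval : unfoldTerm K n T μ φ ψ s ((1 : awayFactor K n T) : awayFactor K n T ⧸ awayLevelIn K n T) = ⟪ψ, φ⟫_ℂ := by
      rw [unfoldTerm_mk hφ, Subgroup.coe_one, map_one, NNReal.coe_one, Complex.ofReal_one, Complex.one_cpow,
        one_mul, rightRegular_one_apply]
    rw [Finset.prod_empty, one_mul]
    convert hasSum_fintype (fun γ : intCosetsIn K n T (∅ : Finset (HeightOneSpectrum (𝓞 K))) =>
      unfoldTerm K n T μ φ ψ s γ.1)
    rw [Finset.univ_unique, Finset.sum_singleton]
    exact hval.symm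
  | insert w S₀ hw₀ ih =>
    have hwT : w ∉ T := hS w (Finset.mem_insert_self w S₀)
    have hS₀ : ∀ w' ∈ S₀, w' ∉ T := fun w' hw' => hS w' (Finset.mem_insert_of_mem hw')
    have ih' := ih hS₀
    -- Satake data and the Hecke eigen-series at `w`
    obtain ⟨𝔫, h𝔫, hw𝔫, ϖ, hSat⟩ := hα w (by exact_mod_cast hwT)
    have hval : Valued.v (ϖ : w.adicCompletion K) = WithZero.exp (-1 : ℤ) := hSat.1
    have hϖ : IsUniformizingElement (ϖ : w.adicCompletion K) := isUniformizingElement_of_valued_eq K w hval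
    obtain ⟨r, hr, hmk, hrB, hcard⟩ := exists_heckeDetEigenvalues_rightRegularLocal (μ := μ) P h𝔫 hw𝔫 hSat hϖ
    set D : ℝ := (2 : ℝ) ^ n * (w.residueCard : ℝ) ^ (n * n) with hD
    have hD0 : 0 ≤ D := by positivity
    set X : ℂ := (w.residueCard : ℂ) ^ (-s) with hX
    have hXD : ‖X‖ * D < 1 := norm_cpow_neg_mul_lt_one (n := n) w hs
    set E : ℂ := localEulerInv n (α w) w s with hE
    -- the translates `R(x) φ`, `x` supported in `S₀`, are spherical at `w`
    set v : intCosetsIn K n T S₀ → (AdelicGroupData.gl n K).L2 μ := fun γ' =>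
      (AdelicGroupData.gl n K).rightRegular μ ((γ'.1.out : awayFactor K n T) : GL (Fin n) (AdeleRing (𝓞 K) K)) φ
      with hv
    have hvsph : ∀ γ', v γ' ∈ sphericalVectorsAt μ P w := fun γ' =>
      mem_sphericalVectorsAt_iff.2 ⟨P.1.apply_mem _ hφP, fun k hk =>
        rightRegular_ofLocal_rightRegular_eq hwT hφ (γ'.2.2 w hw₀) hk⟩
    -- the weights
    set W : intCosetsIn K n T S₀ → ℂ := fun γ' =>
      ((adelicAbsDet n K ((γ'.1.out : awayFactor K n T) : GL (Fin n) (AdeleRing (𝓞 K) K)) : ℝ) : ℂ) ^ s with hW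
    -- inner sums (Tamagawa at `w`)
    have hinner : ∀ γ' : intCosetsIn K n T S₀, HasSum (fun c : intCosets n (w.adicCompletion K) =>
        W γ' * (X ^ detExponent hϖ c * ⟪ψ, (AdelicGroupData.gl n K).rightRegular μ
          (GLn.ofLocal n K w (c.1.out : GL (Fin n) (w.adicCompletion K))) (v γ')⟫_ℂ))
        (W γ' * (E * ⟪ψ, v γ'⟫_ℂ)) := fun γ' =>
      (hasSum_intCosets_inner_rightRegularLocal hϖ hr hmk hD0 hrB hcard (hvsph γ') ψ hXD).mul_left (W γ')
    -- the family on the product, in the order `(x, y)`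
    set G : intCosetsIn K n T S₀ × intCosets n (w.adicCompletion K) → ℂ := fun p =>
      unfoldTerm K n T μ φ ψ s (stepElt hwT p.2 p.1.1 : awayFactor K n T ⧸ awayLevelIn K n T) with hG
    have hGeq : ∀ p : intCosetsIn K n T S₀ × intCosets n (w.adicCompletion K),
        G p = W p.1 * (X ^ detExponent hϖ p.2 * ⟪ψ, (AdelicGroupData.gl n K).rightRegular μ
          (GLn.ofLocal n K w (p.2.1.out : GL (Fin n) (w.adicCompletion K))) (v p.1)⟫_ℂ) := fun p => by
      rw [hG, hW, hv]
      dsimp only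
      rw [unfoldTerm_stepElt hwT hφ, norm_det_out_cpow_eq hval hϖ]
    -- absolute convergence of `G` from the weights
    have hwloc := (hasSum_norm_det_rpow (n := n) w hs).1
    have hwS₀ := hasSum_unfoldWeight (T := T) hs S₀ hS₀
    have hGsum : Summable G := by
      have hbd := (hwS₀.summable.mul_of_nonneg hwloc.summable (fun γ => unfoldWeight_nonneg _ γ.1)
        (fun c => Real.rpow_nonneg (norm_nonneg _) _)).mul_left (‖ψ‖ * ‖φ‖)
      refine Summable.of_norm_bounded hbd fun p => ?_
      rw [hG]
      dsimp only
      refine (norm_unfoldTerm_le φ ψ s _).trans (le_of_eq ?_)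
      rw [unfoldWeight_stepElt]
      ring
    -- fibrewise summation and comparison with the outer sum
    have hfib : HasSum (fun γ' : intCosetsIn K n T S₀ => W γ' * (E * ⟪ψ, v γ'⟫_ℂ)) (∑' p, G p) :=
      hGsum.hasSum.prod_fiberwise fun γ' => (hinner γ').congr_fun fun c => hGeq (γ', c)
    have houter : HasSum (fun γ' : intCosetsIn K n T S₀ => W γ' * (E * ⟪ψ, v γ'⟫_ℂ))
        (E * ((∏ w' ∈ S₀, localEulerInv n (α w') w' s) * ⟪ψ, φ⟫_ℂ)) := by
      refine (ih'.mul_left E).congr_fun fun γ' => ?_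
      rw [hW, hv, unfoldTerm]
      ring
    have htsum : ∑' p, G p = E * ((∏ w' ∈ S₀, localEulerInv n (α w') w' s) * ⟪ψ, φ⟫_ℂ) := hfib.unique houter
    have hGhas : HasSum G (E * ((∏ w' ∈ S₀, localEulerInv n (α w') w' s) * ⟪ψ, φ⟫_ℂ)) := htsum ▸ hGsum.hasSum
    -- transport to the cosets supported in `S₀ ∪ {w}`
    rw [Finset.prod_insert hw₀, mul_assoc]
    refine ((stepEquiv hwT hw₀).hasSum_iff (f := fun γ : intCosetsIn K n T (insert w S₀) =>
      unfoldTerm K n T μ φ ψ s γ.1)).1 ?_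
    refine ((Equiv.prodComm (intCosetsIn K n T S₀) (intCosets n (w.adicCompletion K))).hasSum_iff
      (f := (fun γ : intCosetsIn K n T (insert w S₀) => unfoldTerm K n T μ φ ψ s γ.1) ∘ stepEquiv hwT hw₀)).1 ?_
    exact hGhas

end Terms

/-! ### Passing to all integral cosets: dominated convergence and the Euler product -/

section Limit

open scoped Classical InnerProductSpace Topology
open MeasureTheory Filter

variable {K : Type} [Field K] [NumberField K] {n : ℕ} {T : Finset (HeightOneSpectrum (𝓞 K))}

/-- Supports may be taken disjoint from `T` (the components at `T` are `1`). [folklore] -/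
theorem IsSupportedIn.sdiff {S : Finset (HeightOneSpectrum (𝓞 K))} {x : awayFactor K n T}
    (h : IsSupportedIn S x) : IsSupportedIn (S \ T) x := by
  intro w hw
  rw [Finset.mem_sdiff, not_and, not_not] at hw
  by_cases hwS : w ∈ S
  · rw [toLocalAway_eq_one_of_mem (hw hwS)]
    exact one_mem _
  · exact h w hwS

/-- Every integral coset is supported in a finite set of places disjoint from `T`. [folklore] -/
theorem exists_mem_intCosetsIn_disjoint {γ : awayFactor K n T ⧸ awayLevelIn K n T}
    (hγ : γ ∈ intCosetsAway K n T) : ∃ S : Finset (HeightOneSpectrum (𝓞 K)), (∀ w ∈ S, w ∉ T) ∧ γ ∈ intCosetsIn K n T S := by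
  obtain ⟨S, hS⟩ := exists_mem_intCosetsIn hγ
  exact ⟨S \ T, fun w hw => (Finset.mem_sdiff.1 hw).2, hS.1, hS.2.sdiff⟩

/-- The uniform bound `∏_{w ∈ S} Λ_w(σ) ≤ exp (∑_w 2 q_w^{-σ} 2^n q_w^{n²}) < ∞`. [folklore] -/
theorem summable_localWeightBound {σ : ℝ} (hσ : (n : ℝ) * n + n + 2 ≤ σ) :
    Summable fun w : HeightOneSpectrum (𝓞 K) =>
      2 * ((w.residueCard : ℝ) ^ (-σ) * ((2 : ℝ) ^ n * (w.residueCard : ℝ) ^ (n * n))) := by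
  have hs : 1 < σ - n * n := by nlinarith [n.cast_nonneg (α := ℝ)]
  have h := (summable_residueCard_rpow_neg (K := K) hs).mul_left (2 * (2 : ℝ) ^ n)
  refine h.congr fun w => ?_
  have hq0 : (0 : ℝ) < w.residueCard := by exact_mod_cast lt_trans zero_lt_one w.one_lt_residueCard
  rw [← Real.rpow_natCast _ (n * n), show ((n * n : ℕ) : ℝ) = (n : ℝ) * n by push_cast; ring,
    show -(σ - (n : ℝ) * n) = -σ + n * n by ring, Real.rpow_add hq0]
  ring

/-- `∏_{w ∈ S} Λ_w(σ) ≤ exp (∑_w 2 q_w^{-σ} 2^n q_w^{n²})`, uniformly in `S`. [folklore] -/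
theorem prod_localWeightSum_le {σ : ℝ} (hσ : (n : ℝ) * n + n + 2 ≤ σ) (S : Finset (HeightOneSpectrum (𝓞 K))) :
    ∏ w ∈ S, localWeightSum n w σ ≤ Real.exp (∑' w : HeightOneSpectrum (𝓞 K),
      2 * ((w.residueCard : ℝ) ^ (-σ) * ((2 : ℝ) ^ n * (w.residueCard : ℝ) ^ (n * n)))) := by
  set b : HeightOneSpectrum (𝓞 K) → ℝ := fun w =>
    2 * ((w.residueCard : ℝ) ^ (-σ) * ((2 : ℝ) ^ n * (w.residueCard : ℝ) ^ (n * n))) with hb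
  have hb0 : ∀ w, 0 ≤ b w := fun w => by positivity
  calc ∏ w ∈ S, localWeightSum n w σ ≤ ∏ w ∈ S, (1 + b w) := by
        refine Finset.prod_le_prod (fun w _ => ?_) (fun w _ => ?_)
        · exact le_trans zero_le_one (hasSum_norm_det_rpow (n := n) w hσ).2.1
        · have h : localWeightSum n w σ - 1 ≤ b w := (hasSum_norm_det_rpow (n := n) w hσ).2.2
          linarith
    _ ≤ Real.exp (∑ w ∈ S, b w) := Real.prod_one_add_le_exp_sum S hb0
    _ ≤ Real.exp (∑' w, b w) :=
        Real.exp_le_exp.2 ((summable_localWeightBound (K := K) hσ).sum_le_tsum S fun w _ => hb0 w)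

/-- Finitely many integral cosets are supported in a common finite set of places disjoint from `T`.
[folklore] -/
theorem exists_forall_mem_intCosetsIn (u : Finset (awayFactor K n T ⧸ awayLevelIn K n T)) :
    ∃ S : Finset (HeightOneSpectrum (𝓞 K)), (∀ w ∈ S, w ∉ T) ∧
      ∀ γ ∈ u, γ ∈ intCosetsAway K n T → γ ∈ intCosetsIn K n T S := by
  induction u using Finset.induction_on with
  | empty => exact ⟨∅, fun w hw => absurd hw (Finset.notMem_empty w), fun γ hγ => absurd hγ (Finset.notMem_empty γ)⟩
  | insert γ₀ u hγ₀ ih =>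
    obtain ⟨S, hST, hS⟩ := ih
    by_cases h₀ : γ₀ ∈ intCosetsAway K n T
    · obtain ⟨S₀, hS₀T, hγS₀⟩ := exists_mem_intCosetsIn_disjoint h₀
      refine ⟨S ∪ S₀, fun w hw => ?_, fun γ hγ hγA => ?_⟩
      · rcases Finset.mem_union.1 hw with h | h
        · exact hST w h
        · exact hS₀T w h
      · rcases Finset.mem_insert.1 hγ with rfl | hγu
        · exact intCosetsIn_mono Finset.subset_union_right hγS₀
        · exact intCosetsIn_mono Finset.subset_union_left (hS γ hγu hγA)
    · refine ⟨S, hST, fun γ hγ hγA => ?_⟩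
      rcases Finset.mem_insert.1 hγ with rfl | hγu
      · exact absurd hγA h₀
      · exact hS γ hγu hγA

/-- The finite partial sums of the weights over integral cosets are uniformly bounded. [folklore] -/
theorem sum_indicator_unfoldWeight_le {σ : ℝ} (hσ : (n : ℝ) * n + n + 2 ≤ σ)
    (u : Finset (awayFactor K n T ⧸ awayLevelIn K n T)) :
    ∑ γ ∈ u, (intCosetsAway K n T).indicator (unfoldWeight K n T σ) γ ≤
      Real.exp (∑' w : HeightOneSpectrum (𝓞 K),
        2 * ((w.residueCard : ℝ) ^ (-σ) * ((2 : ℝ) ^ n * (w.residueCard : ℝ) ^ (n * n)))) := by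
  obtain ⟨S, hST, hsub⟩ := exists_forall_mem_intCosetsIn u
  have hle : ∀ γ ∈ u, (intCosetsAway K n T).indicator (unfoldWeight K n T σ) γ ≤
      (intCosetsIn K n T S).indicator (unfoldWeight K n T σ) γ := fun γ hγu => by
    by_cases hγ : γ ∈ intCosetsAway K n T
    · rw [Set.indicator_of_mem hγ, Set.indicator_of_mem (hsub γ hγu hγ)]
    · rw [Set.indicator_of_notMem hγ]
      exact Set.indicator_nonneg (fun γ _ => unfoldWeight_nonneg σ γ) γ
  have hsumS : HasSum ((intCosetsIn K n T S).indicator (unfoldWeight K n T σ)) (∏ w ∈ S, localWeightSum n w σ) :=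
    (hasSum_subtype_iff_indicator (f := unfoldWeight K n T σ) (s := intCosetsIn K n T S)).1
      (hasSum_unfoldWeight (T := T) hσ S hST)
  have h1 : ∑ γ ∈ u, (intCosetsAway K n T).indicator (unfoldWeight K n T σ) γ ≤
      ∑ γ ∈ u, (intCosetsIn K n T S).indicator (unfoldWeight K n T σ) γ := Finset.sum_le_sum hle
  have h2 : ∑ γ ∈ u, (intCosetsIn K n T S).indicator (unfoldWeight K n T σ) γ ≤ ∏ w ∈ S, localWeightSum n w σ :=
    sum_le_hasSum u (fun γ _ => Set.indicator_nonneg (fun γ _ => unfoldWeight_nonneg σ γ) γ) hsumS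
  exact h1.trans (h2.trans (prod_localWeightSum_le hσ S))

/-- **Absolute convergence over all integral cosets**: `∑_{x K^T ∈ Δ^T K^T/K^T} |det x|_𝔸^σ < ∞` for
`σ ≥ n² + n + 2` (the partial sums over cosets supported in `S` are `∏_{w ∈ S} Λ_w(σ)`, uniformly
bounded). [folklore] -/
theorem summable_unfoldWeight {σ : ℝ} (hσ : (n : ℝ) * n + n + 2 ≤ σ) :
    Summable fun γ : intCosetsAway K n T => unfoldWeight K n T σ γ.1 :=
  (summable_subtype_iff_indicator (s := intCosetsAway K n T) (f := unfoldWeight K n T σ)).2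
    (summable_of_sum_le (fun γ => Set.indicator_nonneg (fun γ _ => unfoldWeight_nonneg σ γ) γ)
      (sum_indicator_unfoldWeight_le hσ))

variable {μ : Measure (AdelicGroupData.gl n K).automorphicQuotient}
  [(AdelicGroupData.gl n K).IsAutomorphicMeasure μ]

/-- Absolute convergence of the unfolded coefficient over all integral cosets. [folklore] -/
theorem summable_norm_unfoldTerm (φ ψ : (AdelicGroupData.gl n K).L2 μ) {s : ℂ} (hs : (n : ℝ) * n + n + 2 ≤ s.re) :
    Summable fun γ : intCosetsAway K n T => ‖unfoldTerm K n T μ φ ψ s γ.1‖ :=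
  Summable.of_nonneg_of_le (fun _ => norm_nonneg _) (fun γ => norm_unfoldTerm_le φ ψ s γ.1)
    ((summable_unfoldWeight (T := T) hs).mul_left (‖ψ‖ * ‖φ‖))

/-- The sum over the cosets supported in `S`, as a restricted sum over all integral cosets. [folklore] -/
theorem tsum_ite_mem_intCosetsIn (φ ψ : (AdelicGroupData.gl n K).L2 μ) (s : ℂ) (S : Finset (HeightOneSpectrum (𝓞 K))) :
    ∑' γ : intCosetsAway K n T, (if γ.1 ∈ intCosetsIn K n T S then unfoldTerm K n T μ φ ψ s γ.1 else 0) =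
      ∑' γ : intCosetsIn K n T S, unfoldTerm K n T μ φ ψ s γ.1 := by
  have h1 : (fun γ : intCosetsAway K n T => if γ.1 ∈ intCosetsIn K n T S then unfoldTerm K n T μ φ ψ s γ.1 else 0) =
      fun γ : intCosetsAway K n T => (intCosetsIn K n T S).indicator (unfoldTerm K n T μ φ ψ s) γ.1 := by
    funext γ
    rfl
  rw [h1, tsum_subtype (intCosetsAway K n T) ((intCosetsIn K n T S).indicator (unfoldTerm K n T μ φ ψ s)),
    Set.indicator_indicator, Set.inter_eq_right.2 (intCosetsIn_subset_intCosetsAway S), tsum_subtype]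

/-- **The partial Euler products converge to the full unfolded coefficient** (Tannery's theorem /
dominated convergence over the integral cosets, with the weights as majorant): for the family
`E_i = (∏_{a ∈ α i} (1 - q_i^{(n-1)/2} a q_i^{-s}))⁻¹` indexed by the finite places `i ∉ T`,
`(∏_{i ∈ S} E_i) ⟪ψ, φ⟫ → ∑_{x K^T ∈ Δ^T K^T / K^T} |det x|_𝔸^s ⟪ψ, R(x) φ⟫` along the finite
subsets `S`. [folklore] -/
theorem tendsto_prod_localEulerInv_mul_inner (P : CuspidalAutomorphicRepGL n K μ) {α : SatakeFamily K}
    (hα : IsSatakeFamilyOf P (↑T : Set (HeightOneSpectrum (𝓞 K))) α)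
    {φ : (AdelicGroupData.gl n K).L2 μ} (hφP : φ ∈ P.1)
    (hφ : ∀ k ∈ awayLevel K n T, (AdelicGroupData.gl n K).rightRegular μ k φ = φ)
    (ψ : (AdelicGroupData.gl n K).L2 μ) {s : ℂ} (hs : (n : ℝ) * n + n + 2 ≤ s.re) :
    Tendsto (fun S : Finset {w : HeightOneSpectrum (𝓞 K) // w ∉ T} =>
        (∏ i ∈ S, localEulerInv n (α i.1) i.1 s) * ⟪ψ, φ⟫_ℂ) atTop
      (𝓝 (∑' γ : intCosetsAway K n T, unfoldTerm K n T μ φ ψ s γ.1)) := by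
  -- dominated convergence for the restricted sums
  set f : Finset {w : HeightOneSpectrum (𝓞 K) // w ∉ T} → intCosetsAway K n T → ℂ := fun S γ =>
    if γ.1 ∈ intCosetsIn K n T (S.image Subtype.val) then unfoldTerm K n T μ φ ψ s γ.1 else 0 with hf
  have h_sum := (summable_unfoldWeight (T := T) hs).mul_left (‖ψ‖ * ‖φ‖)
  have hab : ∀ γ : intCosetsAway K n T, Tendsto (fun S => f S γ) atTop (𝓝 (unfoldTerm K n T μ φ ψ s γ.1)) := by
    intro γ
    obtain ⟨S₀, hS₀T, hγ⟩ := exists_mem_intCosetsIn_disjoint γ.2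
    refine tendsto_const_nhds.congr' ?_
    rw [EventuallyEq, eventually_atTop]
    refine ⟨S₀.subtype (fun w => w ∉ T), fun S hS => ?_⟩
    rw [hf]
    dsimp only
    rw [if_pos]
    refine intCosetsIn_mono (fun w hw => ?_) hγ
    rw [Finset.mem_image]
    exact ⟨⟨w, hS₀T w hw⟩, hS (Finset.mem_subtype.2 hw), rfl⟩
  have h_bound : ∀ᶠ S in atTop, ∀ γ : intCosetsAway K n T, ‖f S γ‖ ≤ ‖ψ‖ * ‖φ‖ * unfoldWeight K n T s.re γ.1 := by
    refine Eventually.of_forall fun S γ => ?_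
    rw [hf]
    dsimp only
    split_ifs
    · exact norm_unfoldTerm_le φ ψ s γ.1
    · rw [norm_zero]
      exact mul_nonneg (mul_nonneg (norm_nonneg _) (norm_nonneg _)) (unfoldWeight_nonneg _ _)
  have hT := tendsto_tsum_of_dominated_convergence h_sum hab h_bound
  refine hT.congr fun S => ?_
  -- the restricted sum is the finite Euler product
  have hST : ∀ w ∈ S.image Subtype.val, w ∉ T := fun w hw => by
    obtain ⟨i, -, rfl⟩ := Finset.mem_image.1 hw
    exact i.2
  change ∑' γ : intCosetsAway K n T, f S γ = _
  rw [hf]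
  dsimp only
  rw [tsum_ite_mem_intCosetsIn, (hasSum_unfoldTerm P hα hφP hφ ψ hs _ hST).tsum_eq,
    Finset.prod_image fun i _ j _ h => Subtype.ext h]

/-- **The unfolded coefficient over all integral cosets is the partial Euler product**: for `Π`
cuspidal with Satake family `α` off `T`, `0 ≠ φ ∈ Π^{K^T}`, `ψ ∈ L²` and `re s ≥ n² + n + 2`, the
Euler product `∏_{w ∉ T} (∏_{a ∈ α w} (1 - q_w^{(n-1)/2} a q_w^{-s}))⁻¹` converges and
`∑_{x K^T ∈ Δ^T K^T / K^T} |det x|_𝔸^s ⟪ψ, R(x) φ⟫ = (∏_{w ∉ T} (∏_{a ∈ α w} (1 - q_w^{(n-1)/2} a q_w^{-s}))⁻¹) ⟪ψ, φ⟫`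
— the away-from-`T` part of Godement–Jacquet's Euler factorisation `Z = ∏_v Z_v` with the
unramified computation `Z_w(1_{M_n(𝒪_w)}, s, ω°) = L(s - (n-1)/2, Π_w)`, in the `L²`-model
(Godement–Jacquet (1972), Thm. 13.8 (proof) and Lemma 6.10; Jacquet (1979), §6).
[cite: GodementJacquet1972, Lemma 6.10] -/
theorem hasSum_unfoldTerm_intCosetsAway (P : CuspidalAutomorphicRepGL n K μ) {α : SatakeFamily K}
    (hα : IsSatakeFamilyOf P (↑T : Set (HeightOneSpectrum (𝓞 K))) α)
    {φ : (AdelicGroupData.gl n K).L2 μ} (hφP : φ ∈ P.1) (hφ0 : φ ≠ 0)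
    (hφ : ∀ k ∈ awayLevel K n T, (AdelicGroupData.gl n K).rightRegular μ k φ = φ)
    (ψ : (AdelicGroupData.gl n K).L2 μ) {s : ℂ} (hs : (n : ℝ) * n + n + 2 ≤ s.re) :
    Multipliable (fun i : {w : HeightOneSpectrum (𝓞 K) // w ∉ T} => localEulerInv n (α i.1) i.1 s) ∧
      HasSum (fun γ : intCosetsAway K n T => unfoldTerm K n T μ φ ψ s γ.1)
        ((∏' i : {w : HeightOneSpectrum (𝓞 K) // w ∉ T}, localEulerInv n (α i.1) i.1 s) * ⟪ψ, φ⟫_ℂ) := by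
  -- multipliability from the case `ψ = φ`
  have hφφ : ⟪φ, φ⟫_ℂ ≠ 0 := inner_self_ne_zero.2 hφ0
  have h1 := tendsto_prod_localEulerInv_mul_inner P hα hφP hφ φ hs
  have hprod : HasProd (fun i : {w : HeightOneSpectrum (𝓞 K) // w ∉ T} => localEulerInv n (α i.1) i.1 s)
      ((∑' γ : intCosetsAway K n T, unfoldTerm K n T μ φ φ s γ.1) / ⟪φ, φ⟫_ℂ) := by
    have h2 := h1.div_const ⟪φ, φ⟫_ℂ
    refine h2.congr fun S => ?_
    rw [mul_div_cancel_right₀ _ hφφ]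
  refine ⟨hprod.multipliable, ?_⟩
  -- the general case by uniqueness of limits
  have h3 := tendsto_prod_localEulerInv_mul_inner P hα hφP hφ ψ hs
  have h4 : Tendsto (fun S : Finset {w : HeightOneSpectrum (𝓞 K) // w ∉ T} =>
      (∏ i ∈ S, localEulerInv n (α i.1) i.1 s) * ⟪ψ, φ⟫_ℂ) atTop
        (𝓝 ((∏' i : {w : HeightOneSpectrum (𝓞 K) // w ∉ T}, localEulerInv n (α i.1) i.1 s) * ⟪ψ, φ⟫_ℂ)) :=
    (hprod.multipliable.hasProd).mul_const _
  rw [← tendsto_nhds_unique h3 h4]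
  exact (summable_norm_unfoldTerm φ ψ hs).of_norm.hasSum

end Limit

end Literature.NumberTheory.Automorphic
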